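import Mathlib.RingTheory.Ideal.Norm.RelNorm
import Mathlib.RingTheory.DedekindDomain.IntegralClosure
import Mathlib.RingTheory.Localization.AsSubring
import Mathlib.RingTheory.DedekindDomain.Dvr
import Literature.NumberTheory.EllipticCurves.IsogenyHomProofs
import Literature.NumberTheory.EllipticCurves.CoordinateRingRegular
import HarnessLib

/-!
# Isogenies from explicit rational maps (Silverman, *AEC*, Thm. III.4.8)

Trunk T-ELLARITH; topic `NumberTheory/EllipticCurves`, notion `cm_endomorphisms_isogeny` (explicit
isogenies). The prelude `Literature.NumberTheory.EllipticCurves.Isogeny` records an isogeny over `K`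
by its `Γ_K`-equivariant, algebraic, finite-kernel **homomorphism** on `K̄`-points, so to exhibit an
isogeny from explicit formulae one must prove that the formulae define a group homomorphism. The
tree's two explicit isogenies (`IsogenyTwoTorsionProofs`, degree `2`; `ThreeIsogeny`, degree `3`)
do this by certified chord–tangent identities, which is infeasible in higher degree. This file
proves the general statement behind it — *a rational map `E₁ → E₂` with `O ↦ O` is a
homomorphism* (AEC III.4.8) — for maps given in the standard form
`(x, y) ↦ (U(x)/h(x)², (S(x)·y + T(x))/h(x)³)`, from the two obviously necessary polynomial
identities (the equation of `E₂` pulls back to `S² ·` the equation of `E₁`) and the degree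
condition `deg h² < deg U` (`O ↦ O`). No hypothesis on the roots of `h` (kernel) is needed.

## Main definitions and results

* `WeierstrassCurve.IsogenyFormula W₁ W₂`: the data `U h S T ∈ R[X]` with the two identities,
  `h ≠ 0` and `deg h² < deg U`; `IsogenyFormula.map` (base change).
* `IsogenyFormula.pointFun`: the map on `F`-points (`F` a field), `(a, b) ↦ (U(a)/h(a)²,
  (S(a) b + T(a))/h(a)³)` when `h(a) ≠ 0` (`equation_val`: it lands on `W₂`).
* `IsogenyFormula.pointFun_add_of_eval_ne_zero`, `IsogenyFormula.pointFun_add` (**AEC III.4.8**):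
  `f(P + Q) = f(P) + f(Q)` whenever `P, Q, P + Q` are affine points with `h(x) ≠ 0`
  (`char F = 0`, `W₁, W₂` elliptic).
* `IsogenyFormula.toIsogeny : Isogeny W₁ W₂` over any field `K` of characteristic `0`, and
  `isIsogenous_of_isogenyFormula : IsIsogenous W₁ W₂`; `toIsogeny_some`: on `K̄`-points with
  `h(x) ≠ 0` the isogeny is the formula.
* Tools of independent interest: `Literature.NumberTheory.EllipticCurves.RationalMapHom.extend` (a map on an infinite abelian group
  which is additive off a finite set extends to a homomorphism agreeing with it off that set;
  uniqueness is the tree's `Literature.NumberTheory.EllipticCurves.AddMonoidHom.eq_of_eqOn_compl_finite` of `IsogenyHomProofs`),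
  `Literature.NumberTheory.EllipticCurves.RationalMapHom.isMaximal_XYIdeal`, `Literature.NumberTheory.EllipticCurves.RationalMapHom.localRingAt` (the local ring
  `𝒪_{W,P} ⊆ L` at an `F`-point). Infinitude of `E(K̄)` and `(W.baseChange A).IsElliptic` are the
  tree's (`DivisionPolynomialTorsion`, `IsogenyHomProofs`).

## The proof (AEC III.4.8 through Mathlib's class-group model of the group law)

Mathlib proves the group law on `W(F)` by the injective homomorphism
`toClass : W(F) → Cl(F[W])`, `P ↦ [𝔪_P]` (`WeierstrassCurve.Affine.Point.toClass`), and the tree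
knows that `F[W]` is a Dedekind domain (`CoordinateRingRegular`). Given a formula `W₁ → W₂` over a
field `F`, let `L = F(W₁)` and `ψ : F[W₂] → L`, `x₂ ↦ x' = U(x₁)/h(x₁)²`,
`y₂ ↦ y' = (S(x₁)y₁ + T(x₁))/h(x₁)³` (well defined by the identities, `IsogenyFormula.psi`); it is
injective because `x'` is transcendental (`deg h² < deg U`, `psi_injective`), and `x₁, y₁` are
integral over `F[W₂]` (`x₁` is a root of the monic `lc(U)⁻¹(U(Z) - x₂ h(Z)²)`; `y₁` of the
Weierstrass equation), so `F[W₁] ⊆ A :=` the integral closure of `F[W₂]` in `L`, a Dedekind domain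
finite over `F[W₂]` (`[L : F(W₂)] < ∞`, separability in characteristic `0`; Mathlib
`integralClosure.isDedekindDomain_fractionRing`, `IsIntegralClosure.finite`). For an affine point
`P = (a, b)` with `h(a) ≠ 0`, `ψ` lands in the discrete valuation ring `𝒪_{W₁,P}`, which is
integrally closed, so `A ⊆ 𝒪_{W₁,P}`; it follows that `𝔪_P A` is a maximal ideal of `A` with
residue field `F`, lying over `𝔪_{f(P)}` with inertia degree `1`, whence
`relNorm (𝔪_P A) = 𝔪_{f(P)}` (Mathlib `Ideal.relNorm_eq_pow_of_isMaximal`;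
`Literature.NumberTheory.EllipticCurves.RationalMapHom.relNorm_map_incl`). If `P + Q = S` then `(α) 𝔪_P 𝔪_Q = (β) 𝔪_S` in `F[W₁]`
for some `α, β ≠ 0` (Mathlib `ClassGroup.mk_eq_mk_of_coe_ideal`); extending to `A` and taking
relative norms gives `(Nα) 𝔪_{f P} 𝔪_{f Q} = (Nβ) 𝔪_{f S}`, i.e. `f P + f Q = f S` by injectivity of
`toClass` on `W₂(F)` (`Literature.NumberTheory.EllipticCurves.RationalMapHom.some_add_some_eq`). This is Silverman's proof of
III.4.8 (PDF pp. 70–71: `φ` induces `φ_*` on `Pic⁰`, II.3.7, and `κ₂` is injective, III.3.4)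
written for the affine Dedekind rings. Over `K̄` the set `{O} ∪ {h(x) = 0}` is finite and `E₁(K̄)` is infinite (tree:
`geomPoints.instInfinite`), so the map extends uniquely to a homomorphism
(`Literature.NumberTheory.EllipticCurves.RationalMapHom.extend`), which is algebraic off that finite set, `Γ_K`-equivariant
(uniqueness, `Literature.NumberTheory.EllipticCurves.AddMonoidHom.eq_of_eqOn_compl_finite`) and has finite kernel
(`IsAlgebraicOn.finite_ker`).

## References

* [SilvermanAEC2009] J. H. Silverman, *The Arithmetic of Elliptic Curves*, 2nd ed., GTM 106,
  Springer 2009 (held: `book:silverman2009-arithmetic-elliptic-curves-2nd-ed`): Prop. II.1.1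
  (local rings at smooth points are DVRs), Prop. II.3.7 (`φ_* : Pic⁰(E₁) → Pic⁰(E₂)`),
  Prop. III.3.4 (`κ : E ≃ Pic⁰(E)`), Thm. III.4.8 ("isogenies are homomorphisms", PDF pp. 70–71,
  proved from II.3.7 and III.3.4), Remarks III.4.13.2–4.13.3 (PDF p. 73: rationality over `K` of
  `E → E/Φ` for a `Γ_K`-stable `Φ`; Vélu's explicit equations).

## Design choices

* Everything curve-specific is a deliberate dot-notation extension in `namespace WeierstrassCurve`
  (`IsogenyFormula` and its namespace); the commutative
  algebra lives in `namespace Literature.RationalMapHom` and is written for an arbitrary fraction field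
  `L` of `F[W₁]` and an arbitrary `F`-algebra structure `F[W₂] → L` making `x₁, y₁` integral
  (`GensIntegral`), the finiteness/Dedekind hypotheses on the integral closure being instance
  arguments discharged in `IsogenyFormula.pointFun_add_of_eval_ne_zero`.
* The identities are stated as the two coefficients (of `Y¹`, `Y⁰`) of
  `h⁶ · W₂(U/h², (SY+T)/h³) = S² · W₁(X, Y)` in `R[X][Y]`, i.e. as identities in `R[X]`, so that
  instances are certified by `ring` on explicit polynomials.
* The value of `pointFun` at the affine points with `h(x) = 0` is a placeholder (`O`); the isogeny
  `toIsogeny` is the unique homomorphism agreeing with the formula elsewhere, so its kernel is only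
  asserted to be finite (no claim that it is `{h = 0}`, which would need `gcd(U, h) = 1`).
* Characteristic `0` is used for separability of `F(W₁)/F(W₂)` and for Mathlib's
  `Ideal.relNorm_eq_pow_of_isMaximal` (`PerfectField (FractionRing F[W₂])`).
* One new instance: `CharZero F[W]` for `[CharZero F]` (`Literature.NumberTheory.EllipticCurves.RationalMapHom.instCharZero`, a
  `Prop` class; no such instance exists in Mathlib or the tree, checked by failing
  `inferInstance`), so nothing is overridden. The instances `(W.baseChange A).IsElliptic` and
  `Infinite (geomPoints W)` used here are the tree's (`DivisionPolynomialTorsion`,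
  `IsogenyHomProofs`).
-/

noncomputable section

open Polynomial
open scoped Polynomial.Bivariate nonZeroDivisors

universe u v

namespace Literature.NumberTheory.EllipticCurves.RationalMapHom

variable {F : Type u} [Field F]

/-! ### Generalities on the coordinate ring `F[W]` -/

section CoordinateRing

variable (W : WeierstrassCurve.Affine F)

/-- `F[W]` has characteristic zero when `F` has. [folklore] -/
instance instCharZero [CharZero F] : CharZero W.CoordinateRing :=
  charZero_of_injective_algebraMap (algebraMap F W.CoordinateRing).injective

/-- The structure map `F[X] → F[W]` sends `p` to `p(x)`: it is `aeval x`. [folklore] -/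
theorem algebraMap_polynomial_eq_aeval (p : F[X]) :
    algebraMap F[X] W.CoordinateRing p =
      aeval (R := F) (WeierstrassCurve.Affine.CoordinateRing.mk W (C X)) p := by
  have : (algebraMap F[X] W.CoordinateRing : F[X] →+* W.CoordinateRing) =
      (aeval (R := F) (WeierstrassCurve.Affine.CoordinateRing.mk W (C X)) :
        F[X] →ₐ[F] W.CoordinateRing).toRingHom := by
    apply Polynomial.ringHom_ext
    · intro c
      rw [AlgHom.toRingHom_eq_coe, RingHom.coe_coe, aeval_C]
      exact (IsScalarTower.algebraMap_apply F F[X] W.CoordinateRing c).symm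
    · rw [AlgHom.toRingHom_eq_coe, RingHom.coe_coe, aeval_X]; rfl
  exact congrArg (fun f : F[X] →+* W.CoordinateRing => f p) this

/-- Every element of `F[W]` is `p(x) + q(x)·y`. [folklore] -/
theorem exists_eq_aeval_add_aeval_mul_y (r : W.CoordinateRing) :
    ∃ p q : F[X], r = aeval (R := F) (WeierstrassCurve.Affine.CoordinateRing.mk W (C X)) p +
      aeval (R := F) (WeierstrassCurve.Affine.CoordinateRing.mk W (C X)) q *
        WeierstrassCurve.Affine.CoordinateRing.mk W Y := by
  obtain ⟨p, q, h⟩ := Literature.NumberTheory.EllipticCurves.WeierstrassCoordinateRing.exists_eq_add_mul_y r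
  exact ⟨p, q, by rw [h, algebraMap_polynomial_eq_aeval, algebraMap_polynomial_eq_aeval]⟩

/-- The maximal ideal `⟨x - a, y - b⟩` of an `F`-point `(a, b)` of `W`. [folklore] -/
theorem isMaximal_XYIdeal {a b : F} (h : W.Equation a b) :
    (WeierstrassCurve.Affine.CoordinateRing.XYIdeal W a (C b)).IsMaximal :=
  Ideal.Quotient.maximal_of_isField _ <|
    MulEquiv.isField (Field.toIsField F)
      (WeierstrassCurve.Affine.CoordinateRing.quotientXYIdealEquiv (W' := W) (x := a) (y := C b)
        h).toMulEquiv

/-- `r - c ∈ ⟨x - a, y - b⟩` for the value `c = r(a, b)`: every element of `F[W]` is congruent to a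
constant modulo the maximal ideal of an `F`-point. [folklore] -/
theorem exists_sub_algebraMap_mem_XYIdeal {a b : F} (h : W.Equation a b) (r : W.CoordinateRing) :
    ∃ c : F, r - algebraMap F W.CoordinateRing c ∈
      WeierstrassCurve.Affine.CoordinateRing.XYIdeal W a (C b) := by
  set e := WeierstrassCurve.Affine.CoordinateRing.quotientXYIdealEquiv (W' := W) (x := a)
    (y := C b) h
  refine ⟨e (Ideal.Quotient.mk _ r), ?_⟩
  rw [← Ideal.Quotient.eq_zero_iff_mem, map_sub, ← e.injective.eq_iff, map_sub, map_zero,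
    Ideal.Quotient.mk_algebraMap, AlgEquiv.commutes, Algebra.algebraMap_self, RingHom.id_apply,
    sub_self]

/-- `XClass W a = x - a`. [folklore] -/
theorem XClass_eq (a : F) : WeierstrassCurve.Affine.CoordinateRing.XClass W a =
    WeierstrassCurve.Affine.CoordinateRing.mk W (C X) - algebraMap F W.CoordinateRing a := by
  simp only [WeierstrassCurve.Affine.CoordinateRing.XClass, map_sub]
  congr 1

/-- `YClass W (C b) = y - b`. [folklore] -/
theorem YClass_eq (b : F) : WeierstrassCurve.Affine.CoordinateRing.YClass W (C b) =
    WeierstrassCurve.Affine.CoordinateRing.mk W Y - algebraMap F W.CoordinateRing b := by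
  simp only [WeierstrassCurve.Affine.CoordinateRing.YClass, map_sub]
  congr 1

/-- The generator `x - a` of `⟨x - a, y - b⟩`. [folklore] -/
theorem mk_X_sub_mem_XYIdeal (a : F) (b : F[X]) :
    WeierstrassCurve.Affine.CoordinateRing.mk W (C X) - algebraMap F W.CoordinateRing a ∈
      WeierstrassCurve.Affine.CoordinateRing.XYIdeal W a b := by
  rw [← XClass_eq]
  exact Ideal.subset_span (Set.mem_insert _ _)

/-- The generator `y - b` of `⟨x - a, y - b⟩`. [folklore] -/
theorem mk_Y_sub_mem_XYIdeal (a b : F) :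
    WeierstrassCurve.Affine.CoordinateRing.mk W Y - algebraMap F W.CoordinateRing b ∈
      WeierstrassCurve.Affine.CoordinateRing.XYIdeal W a (C b) := by
  rw [← YClass_eq]
  exact Ideal.subset_span (Set.mem_insert_of_mem _ (Set.mem_singleton _))

end CoordinateRing

/-! ### The local ring of `W` at an `F`-point, inside a fraction field `L` of `F[W]` -/

section LocalRing

variable (W : WeierstrassCurve.Affine F) (L : Type v) [Field L] [Algebra W.CoordinateRing L]
  [IsFractionRing W.CoordinateRing L]

/-- The local ring `𝒪_{W,P} = F[W]_{𝔪_P}` of `W` at the `F`-point `P = (a, b)`, as a subalgebra of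
a fraction field `L` of `F[W]` (Mathlib `Localization.subalgebra.ofField`). [folklore] -/
def localRingAt {a b : F} (h : W.Equation a b) : Subalgebra W.CoordinateRing L :=
  haveI := isMaximal_XYIdeal W h
  Localization.subalgebra.ofField L
    (WeierstrassCurve.Affine.CoordinateRing.XYIdeal W a (C b)).primeCompl
    (Ideal.primeCompl_le_nonZeroDivisors _)

variable {W L}

/-- Membership in `𝒪_{W,P}`: fractions `r/s` with `s ∉ 𝔪_P`. [folklore] -/
theorem mem_localRingAt_iff {a b : F} (h : W.Equation a b) (z : L) :
    z ∈ localRingAt W L h ↔ ∃ r s : W.CoordinateRing,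
      s ∉ WeierstrassCurve.Affine.CoordinateRing.XYIdeal W a (C b) ∧
        z = algebraMap _ L r * (algebraMap _ L s)⁻¹ := by
  haveI := isMaximal_XYIdeal W h
  change (∃ (r s : W.CoordinateRing) (_ : s ∈ Ideal.primeCompl _), z = _) ↔ _
  exact ⟨fun ⟨r, s, hs, hz⟩ => ⟨r, s, hs, hz⟩, fun ⟨r, s, hs, hz⟩ => ⟨r, s, hs, hz⟩⟩

/-- `r/s ∈ 𝒪_{W,P}` for `s ∉ 𝔪_P`. [folklore] -/
theorem div_mem_localRingAt {a b : F} (h : W.Equation a b) (r : W.CoordinateRing)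
    {s : W.CoordinateRing} (hs : s ∉ WeierstrassCurve.Affine.CoordinateRing.XYIdeal W a (C b)) :
    algebraMap _ L r / algebraMap _ L s ∈ localRingAt W L h :=
  (mem_localRingAt_iff h _).mpr ⟨r, s, hs, div_eq_mul_inv _ _⟩

/-- `𝒪_{W,P}` is the localization of `F[W]` at `𝔪_P`. [folklore] -/
theorem isLocalizationAtPrime_localRingAt {a b : F} (h : W.Equation a b) :
    @IsLocalization.AtPrime _ _ (localRingAt W L h) _ _
      (WeierstrassCurve.Affine.CoordinateRing.XYIdeal W a (C b)) (isMaximal_XYIdeal W h).isPrime := by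
  haveI := isMaximal_XYIdeal W h
  exact Localization.subalgebra.isLocalization_ofField L _ _

/-- `𝒪_{W,P}` is a Dedekind domain (a DVR: Silverman *AEC* II.1.1), in particular integrally
closed in `L`. [folklore] -/
theorem isIntegrallyClosed_localRingAt [W.IsElliptic] {a b : F} (h : W.Equation a b) :
    IsIntegrallyClosed (localRingAt W L h) := by
  haveI := isMaximal_XYIdeal W h
  haveI := isLocalizationAtPrime_localRingAt (L := L) h
  haveI : IsDedekindDomain (localRingAt W L h) :=
    IsLocalization.AtPrime.isDedekindDomain W.CoordinateRing
      (WeierstrassCurve.Affine.CoordinateRing.XYIdeal W a (C b)) _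
  infer_instance

/-- An element of `L` integral over `𝒪_{W,P}` lies in `𝒪_{W,P}`. [folklore] -/
theorem mem_localRingAt_of_isIntegral [W.IsElliptic] {a b : F} (h : W.Equation a b) {z : L}
    (hz : IsIntegral (localRingAt W L h) z) : z ∈ localRingAt W L h := by
  haveI := isIntegrallyClosed_localRingAt (L := L) h
  obtain ⟨y, hy⟩ := IsIntegrallyClosed.algebraMap_eq_of_integral hz
  rw [← hy]
  exact y.2

/-- `1 ∉ 𝔪_P · 𝒪_{W,P}`. [folklore] -/
theorem map_XYIdeal_localRingAt_ne_top {a b : F} (h : W.Equation a b) :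
    (WeierstrassCurve.Affine.CoordinateRing.XYIdeal W a (C b)).map
      (algebraMap W.CoordinateRing (localRingAt W L h)) ≠ ⊤ := by
  haveI := isMaximal_XYIdeal W h
  haveI := isLocalizationAtPrime_localRingAt (L := L) h
  exact (IsLocalization.isPrime_of_isPrime_disjoint
    (WeierstrassCurve.Affine.CoordinateRing.XYIdeal W a (C b)).primeCompl (localRingAt W L h)
    (WeierstrassCurve.Affine.CoordinateRing.XYIdeal W a (C b)) inferInstance
    disjoint_compl_left).ne_top

/-- Products `m · d` with `m ∈ 𝔪_P`, `d ∈ 𝒪_{W,P}` lie in `𝔪_P 𝒪_{W,P}`. [folklore] -/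
theorem mul_mem_map_XYIdeal_localRingAt {a b : F} (h : W.Equation a b) {m : W.CoordinateRing}
    (hm : m ∈ WeierstrassCurve.Affine.CoordinateRing.XYIdeal W a (C b)) (d : localRingAt W L h) :
    (⟨algebraMap _ L m * d, mul_mem (Subalgebra.algebraMap_mem _ m) d.2⟩ : localRingAt W L h) ∈
      (WeierstrassCurve.Affine.CoordinateRing.XYIdeal W a (C b)).map
        (algebraMap W.CoordinateRing (localRingAt W L h)) := by
  have : (⟨algebraMap _ L m * d, mul_mem (Subalgebra.algebraMap_mem _ m) d.2⟩ : localRingAt W L h) =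
      algebraMap W.CoordinateRing (localRingAt W L h) m * d := rfl
  rw [this]
  exact Ideal.mul_mem_right _ _ (Ideal.mem_map_of_mem _ hm)

end LocalRing

/-! ### The abstract setting: an `F`-algebra map `F[W₂] → L ⊇ F[W₁]` making `x₁, y₁` integral -/

section Abstract

variable {W₁ W₂ : WeierstrassCurve.Affine F}
variable {L : Type v} [Field L] [Algebra W₁.CoordinateRing L]

/-- For an algebra structure `F[W₂] → L` on a field `L ⊇ F[W₁]`: the generators `x₁, y₁` of
`F[W₁]` are integral over `F[W₂]` (so that `F[W₁]` lies in the integral closure of `F[W₂]` in `L`).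
[folklore] -/
structure GensIntegral (W₁ W₂ : WeierstrassCurve.Affine F) (L : Type v) [Field L]
    [Algebra W₁.CoordinateRing L] [Algebra W₂.CoordinateRing L] : Prop where
  /-- `x₁` is integral over `F[W₂]`. -/
  isIntegral_X : IsIntegral W₂.CoordinateRing
    (algebraMap W₁.CoordinateRing L (WeierstrassCurve.Affine.CoordinateRing.mk W₁ (C X)))
  /-- `y₁` is integral over `F[W₂]`. -/
  isIntegral_Y : IsIntegral W₂.CoordinateRing
    (algebraMap W₁.CoordinateRing L (WeierstrassCurve.Affine.CoordinateRing.mk W₁ Y))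

section LocalIncl

variable [IsFractionRing W₁.CoordinateRing L] [Algebra W₂.CoordinateRing L] [W₁.IsElliptic]

/-- If `F[W₂] → L` lands in `𝒪_{W₁,P}` then so does the integral closure `A` of `F[W₂]` in `L`
(the local ring is integrally closed). [folklore] -/
theorem integralClosure_le_localRingAt {a b : F} (h : W₁.Equation a b)
    (hreg : ∀ r : W₂.CoordinateRing, algebraMap W₂.CoordinateRing L r ∈ localRingAt W₁ L h)
    {z : L} (hz : z ∈ integralClosure W₂.CoordinateRing L) : z ∈ localRingAt W₁ L h := by
  let ψD : W₂.CoordinateRing →+* localRingAt W₁ L h :=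
    (algebraMap W₂.CoordinateRing L).codRestrict (localRingAt W₁ L h).toSubring hreg
  letI : Algebra W₂.CoordinateRing (localRingAt W₁ L h) := ψD.toAlgebra
  haveI : IsScalarTower W₂.CoordinateRing (localRingAt W₁ L h) L :=
    IsScalarTower.of_algebraMap_eq (fun r => rfl)
  exact mem_localRingAt_of_isIntegral h (IsIntegral.tower_top (A := localRingAt W₁ L h) hz)

/-- The inclusion `j : A → 𝒪_{W₁,P}` at a regular point. [folklore] -/
def inclLocal {a b : F} (h : W₁.Equation a b)
    (hreg : ∀ r : W₂.CoordinateRing, algebraMap W₂.CoordinateRing L r ∈ localRingAt W₁ L h) :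
    integralClosure W₂.CoordinateRing L →+* localRingAt W₁ L h :=
  (integralClosure W₂.CoordinateRing L).val.toRingHom.codRestrict (localRingAt W₁ L h).toSubring
    (fun z => integralClosure_le_localRingAt h hreg z.2)

/-- `j` is the inclusion on underlying elements of `L`. [folklore] -/
@[simp] theorem coe_inclLocal {a b : F} (h : W₁.Equation a b)
    (hreg : ∀ r : W₂.CoordinateRing, algebraMap W₂.CoordinateRing L r ∈ localRingAt W₁ L h)
    (z : integralClosure W₂.CoordinateRing L) : (inclLocal h hreg z : L) = z := rfl

end LocalIncl

section Incl

variable [Algebra F L] [IsScalarTower F W₁.CoordinateRing L]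
variable [Algebra W₂.CoordinateRing L] [IsScalarTower F W₂.CoordinateRing L]

/-- If `x₁, y₁` are integral over `F[W₂]` then `F[W₁] ⊆ A` (and constants lie in `A`). [folklore] -/
theorem algebraMap_mem_integralClosure (hxy : GensIntegral W₁ W₂ L) (r : W₁.CoordinateRing) :
    algebraMap W₁.CoordinateRing L r ∈ integralClosure W₂.CoordinateRing L := by
  have hc : ∀ c : F, algebraMap F L c ∈ integralClosure W₂.CoordinateRing L := by
    intro c
    rw [IsScalarTower.algebraMap_apply F W₂.CoordinateRing L c]
    exact Subalgebra.algebraMap_mem _ _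
  have hp : ∀ p : F[X], algebraMap W₁.CoordinateRing L
      (aeval (R := F) (WeierstrassCurve.Affine.CoordinateRing.mk W₁ (C X)) p) ∈
        integralClosure W₂.CoordinateRing L := by
    intro p
    induction p using Polynomial.induction_on' with
    | add p q hp hq => rw [map_add, map_add]; exact add_mem hp hq
    | monomial n c =>
      rw [← C_mul_X_pow_eq_monomial, map_mul, map_pow, aeval_C, aeval_X, map_mul, map_pow,
        ← IsScalarTower.algebraMap_apply]
      exact mul_mem (hc c) (pow_mem hxy.isIntegral_X n)
  obtain ⟨p, q, rfl⟩ := exists_eq_aeval_add_aeval_mul_y W₁ r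
  rw [map_add, map_mul]
  exact add_mem (hp p) (mul_mem (hp q) hxy.isIntegral_Y)

/-- The inclusion `ι : F[W₁] → A` (when `x₁, y₁` are integral over `F[W₂]`). [folklore] -/
def incl (hxy : GensIntegral W₁ W₂ L) : W₁.CoordinateRing →+* integralClosure W₂.CoordinateRing L :=
  (algebraMap W₁.CoordinateRing L).codRestrict (integralClosure W₂.CoordinateRing L).toSubring
    (algebraMap_mem_integralClosure hxy)

/-- `ι` is `F[W₁] → L` on underlying elements. [folklore] -/
@[simp] theorem coe_incl (hxy : GensIntegral W₁ W₂ L) (r : W₁.CoordinateRing) :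
    (incl hxy r : L) = algebraMap W₁.CoordinateRing L r := rfl

variable [IsFractionRing W₁.CoordinateRing L]

/-- `ι` is injective. [folklore] -/
theorem incl_injective (hxy : GensIntegral W₁ W₂ L) : Function.Injective (incl hxy) := by
  intro r s hrs
  have := congrArg (fun z : integralClosure W₂.CoordinateRing L => (z : L)) hrs
  simpa using this

variable [W₁.IsElliptic]

/-! #### At a regular point `P` of `W₁`: `𝔪_P A` is maximal with residue field `F` -/

/-- `j ∘ ι` is the localization map `F[W₁] → 𝒪_{W₁,P}`. [folklore] -/
theorem inclLocal_comp_incl (hxy : GensIntegral W₁ W₂ L) {a b : F} (h : W₁.Equation a b)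
    (hreg : ∀ r : W₂.CoordinateRing, algebraMap W₂.CoordinateRing L r ∈ localRingAt W₁ L h) :
    (inclLocal h hreg).comp (incl hxy) = algebraMap W₁.CoordinateRing (localRingAt W₁ L h) :=
  RingHom.ext fun _ => Subtype.ext rfl

/-- `𝔪_P A ⊆ j⁻¹(𝔪_P 𝒪_{W₁,P})`. [folklore] -/
theorem map_incl_le_comap (hxy : GensIntegral W₁ W₂ L) {a b : F} (h : W₁.Equation a b)
    (hreg : ∀ r : W₂.CoordinateRing, algebraMap W₂.CoordinateRing L r ∈ localRingAt W₁ L h) :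
    (WeierstrassCurve.Affine.CoordinateRing.XYIdeal W₁ a (C b)).map (incl hxy) ≤
      ((WeierstrassCurve.Affine.CoordinateRing.XYIdeal W₁ a (C b)).map
        (algebraMap W₁.CoordinateRing (localRingAt W₁ L h))).comap (inclLocal h hreg) := by
  rw [Ideal.map_le_iff_le_comap, Ideal.comap_comap, inclLocal_comp_incl]
  exact Ideal.le_comap_map

/-- The extended ideal `𝔪_P A` is proper at a regular point. [folklore] -/
theorem map_incl_ne_top (hxy : GensIntegral W₁ W₂ L) {a b : F} (h : W₁.Equation a b)
    (hreg : ∀ r : W₂.CoordinateRing, algebraMap W₂.CoordinateRing L r ∈ localRingAt W₁ L h) :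
    (WeierstrassCurve.Affine.CoordinateRing.XYIdeal W₁ a (C b)).map (incl hxy) ≠ ⊤ := by
  intro htop
  apply map_XYIdeal_localRingAt_ne_top (W := W₁) (L := L) h
  rw [eq_top_iff]
  calc (⊤ : Ideal (localRingAt W₁ L h))
      = (⊤ : Ideal (integralClosure W₂.CoordinateRing L)).map (inclLocal h hreg) := by
        rw [Ideal.map_top]
    _ ≤ _ := by
        rw [← htop, Ideal.map_le_iff_le_comap]
        exact map_incl_le_comap hxy h hreg

/-- Every element of `A` is congruent to a constant modulo `𝔪_P A` (regular point): for `z = r/s`,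
`s ∉ 𝔪_P`, `s's + i = 1` (`i ∈ 𝔪_P`), `rs' ≡ c`, one has `z - c = z i + (rs' - c) ∈ 𝔪_P A`.
[folklore] -/
theorem exists_sub_algebraMap_mem_map_incl (hxy : GensIntegral W₁ W₂ L) {a b : F}
    (h : W₁.Equation a b)
    (hreg : ∀ r : W₂.CoordinateRing, algebraMap W₂.CoordinateRing L r ∈ localRingAt W₁ L h)
    (z : integralClosure W₂.CoordinateRing L) :
    ∃ c : F, z - algebraMap F _ c ∈
      (WeierstrassCurve.Affine.CoordinateRing.XYIdeal W₁ a (C b)).map (incl hxy) := by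
  obtain ⟨r, s, hs, hz⟩ := (mem_localRingAt_iff h (z : L)).mp
    (integralClosure_le_localRingAt h hreg z.2)
  obtain ⟨s', i, hi, hss'⟩ := (isMaximal_XYIdeal W₁ h).exists_inv hs
  obtain ⟨c, hc⟩ := exists_sub_algebraMap_mem_XYIdeal W₁ h (r * s')
  refine ⟨c, ?_⟩
  have hs0 : algebraMap W₁.CoordinateRing L s ≠ 0 := by
    intro h0
    apply hs
    rw [(IsFractionRing.injective W₁.CoordinateRing L).eq_iff' (map_zero _)] at h0
    rw [h0]; exact Ideal.zero_mem _
  have hS : algebraMap W₁.CoordinateRing L s' * algebraMap _ L s + algebraMap _ L i = 1 := by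
    have := congrArg (algebraMap W₁.CoordinateRing L) hss'
    simpa only [map_add, map_mul, map_one] using this
  have hzS : (z : L) * algebraMap _ L s = algebraMap _ L r := by
    rw [hz, inv_mul_cancel_right₀ hs0]
  have key : z - algebraMap F _ c =
      z * incl hxy i + incl hxy (r * s' - algebraMap F W₁.CoordinateRing c) := by
    apply Subtype.ext
    change (z : L) - algebraMap F L c =
      (z : L) * algebraMap _ L i + algebraMap _ L (r * s' - algebraMap F W₁.CoordinateRing c)
    rw [map_sub, map_mul, ← IsScalarTower.algebraMap_apply F W₁.CoordinateRing L]
    linear_combination (algebraMap W₁.CoordinateRing L s') * hzS - (z : L) * hS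
  rw [key]
  exact Ideal.add_mem _ (Ideal.mul_mem_left _ _ (Ideal.mem_map_of_mem _ hi))
    (Ideal.mem_map_of_mem _ hc)

/-- `𝔪_P A` is a maximal ideal of `A` with residue field `F` (regular point). [folklore] -/
theorem isMaximal_map_incl (hxy : GensIntegral W₁ W₂ L) {a b : F} (h : W₁.Equation a b)
    (hreg : ∀ r : W₂.CoordinateRing, algebraMap W₂.CoordinateRing L r ∈ localRingAt W₁ L h) :
    ((WeierstrassCurve.Affine.CoordinateRing.XYIdeal W₁ a (C b)).map (incl hxy)).IsMaximal := by
  set I := (WeierstrassCurve.Affine.CoordinateRing.XYIdeal W₁ a (C b)).map (incl hxy)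
  have hI : I ≠ ⊤ := map_incl_ne_top hxy h hreg
  haveI : Nontrivial (integralClosure W₂.CoordinateRing L ⧸ I) :=
    Ideal.Quotient.nontrivial_iff.mpr hI
  refine Ideal.Quotient.maximal_of_isField _ ⟨exists_pair_ne _, mul_comm, ?_⟩
  intro q hq
  obtain ⟨z, rfl⟩ := Ideal.Quotient.mk_surjective q
  obtain ⟨c, hc⟩ := exists_sub_algebraMap_mem_map_incl hxy h hreg z
  have hc0 : c ≠ 0 := by
    rintro rfl
    apply hq
    rw [map_zero, sub_zero] at hc
    exact Ideal.Quotient.eq_zero_iff_mem.mpr hc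
  refine ⟨Ideal.Quotient.mk I (algebraMap F _ c⁻¹), ?_⟩
  rw [← map_mul, ← (Ideal.Quotient.mk I).map_one, Ideal.Quotient.eq]
  have : z * algebraMap F _ c⁻¹ - 1 = (z - algebraMap F _ c) * algebraMap F _ c⁻¹ := by
    rw [sub_mul, ← map_mul, mul_inv_cancel₀ hc0, map_one]
  rw [this]
  exact Ideal.mul_mem_right _ _ hc

/-- Every class of `A / 𝔪_P A` is the class of a constant. [folklore] -/
theorem exists_mk_algebraMap_eq (hxy : GensIntegral W₁ W₂ L) {a b : F} (h : W₁.Equation a b)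
    (hreg : ∀ r : W₂.CoordinateRing, algebraMap W₂.CoordinateRing L r ∈ localRingAt W₁ L h)
    (q : integralClosure W₂.CoordinateRing L ⧸
      (WeierstrassCurve.Affine.CoordinateRing.XYIdeal W₁ a (C b)).map (incl hxy)) :
    ∃ c : F, Ideal.Quotient.mk _ (algebraMap F (integralClosure W₂.CoordinateRing L) c) = q := by
  obtain ⟨z, rfl⟩ := Ideal.Quotient.mk_surjective q
  obtain ⟨c, hc⟩ := exists_sub_algebraMap_mem_map_incl hxy h hreg z
  exact ⟨c, ((Ideal.Quotient.eq).mpr hc).symm⟩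

/-- `𝔪_P A = j⁻¹(𝔪_P 𝒪_{W₁,P})` (both are proper, the former is maximal). [folklore] -/
theorem map_incl_eq_comap (hxy : GensIntegral W₁ W₂ L) {a b : F} (h : W₁.Equation a b)
    (hreg : ∀ r : W₂.CoordinateRing, algebraMap W₂.CoordinateRing L r ∈ localRingAt W₁ L h) :
    (WeierstrassCurve.Affine.CoordinateRing.XYIdeal W₁ a (C b)).map (incl hxy) =
      ((WeierstrassCurve.Affine.CoordinateRing.XYIdeal W₁ a (C b)).map
        (algebraMap W₁.CoordinateRing (localRingAt W₁ L h))).comap (inclLocal h hreg) :=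
  (isMaximal_map_incl hxy h hreg).eq_of_le
    (Ideal.comap_ne_top _ (map_XYIdeal_localRingAt_ne_top h)) (map_incl_le_comap hxy h hreg)

/-- Membership test for `𝔪_P A`: an element of `A` of the form `m · d` (`m ∈ 𝔪_P`, `d ∈ 𝒪_{W₁,P}`)
lies in `𝔪_P A`. [folklore] -/
theorem mem_map_incl_of_eq_mul (hxy : GensIntegral W₁ W₂ L) {a b : F} (h : W₁.Equation a b)
    (hreg : ∀ r : W₂.CoordinateRing, algebraMap W₂.CoordinateRing L r ∈ localRingAt W₁ L h)
    {z : integralClosure W₂.CoordinateRing L} {m : W₁.CoordinateRing}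
    (hm : m ∈ WeierstrassCurve.Affine.CoordinateRing.XYIdeal W₁ a (C b)) {d : L}
    (hd : d ∈ localRingAt W₁ L h) (hz : (z : L) = algebraMap _ L m * d) :
    z ∈ (WeierstrassCurve.Affine.CoordinateRing.XYIdeal W₁ a (C b)).map (incl hxy) := by
  rw [map_incl_eq_comap hxy h hreg, Ideal.mem_comap]
  have : inclLocal h hreg z = ⟨algebraMap _ L m * d, mul_mem (Subalgebra.algebraMap_mem _ m) hd⟩ :=
    Subtype.ext hz
  rw [this]
  exact mul_mem_map_XYIdeal_localRingAt h hm ⟨d, hd⟩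

end Incl

end Abstract

/-! ### Norms: `N(𝔪_P A) = 𝔪_{f(P)}` and additivity of the point map -/

section Norm

variable {W₁ W₂ : WeierstrassCurve.Affine F} [W₂.IsElliptic]
variable {L : Type v} [Field L] [Algebra W₁.CoordinateRing L] [Algebra F L]
  [IsScalarTower F W₁.CoordinateRing L]
variable [Algebra W₂.CoordinateRing L] [IsScalarTower F W₂.CoordinateRing L]
  [FaithfulSMul W₂.CoordinateRing L]
variable [Module.Finite W₂.CoordinateRing (integralClosure W₂.CoordinateRing L)]
  [IsDedekindDomain (integralClosure W₂.CoordinateRing L)]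

/-- The relative norm of the extension of a principal ideal `(α) ⊆ F[W₁]` is principal. [folklore] -/
theorem relNorm_map_incl_span_singleton (hxy : GensIntegral W₁ W₂ L) (α : W₁.CoordinateRing) :
    Ideal.relNorm W₂.CoordinateRing ((Ideal.span {α}).map (incl hxy)) =
      Ideal.span {Algebra.intNorm W₂.CoordinateRing (integralClosure W₂.CoordinateRing L)
        (incl hxy α)} := by
  rw [Ideal.map_span, Set.image_singleton, Ideal.relNorm_singleton]

variable [IsFractionRing W₁.CoordinateRing L]

/-- Nonvanishing of the norm of a nonzero element of `F[W₁] ⊆ A`. [folklore] -/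
theorem intNorm_incl_ne_zero (hxy : GensIntegral W₁ W₂ L) {α : W₁.CoordinateRing} (hα : α ≠ 0) :
    Algebra.intNorm W₂.CoordinateRing (integralClosure W₂.CoordinateRing L) (incl hxy α) ≠ 0 := by
  have : Ideal.relNorm W₂.CoordinateRing (Ideal.span {incl hxy α}) ≠ ⊥ := by
    rw [Ne, Ideal.relNorm_eq_bot_iff, Ideal.span_singleton_eq_bot]
    exact (map_ne_zero_iff _ (incl_injective hxy)).mpr hα
  rwa [Ideal.relNorm_singleton, Ne, Ideal.span_singleton_eq_bot] at this

variable [CharZero F] [W₁.IsElliptic]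

/-- **Key lemma** (`φ_*(P) = (φ P)`, the affine ideal-theoretic form of AEC II.3.7). At a point
`P = (a, b)` of `W₁` where `F[W₂] → L` is regular, with value `f(P) = (a', b')` (meaning
`x₂ - a', y₂ - b' ∈ 𝔪_P 𝒪_{W₁,P}`), the relative norm of the extended ideal `𝔪_P A` down to `F[W₂]`
is the maximal ideal `𝔪_{f(P)} = ⟨x - a', y - b'⟩`: indeed `𝔪_P A` is a maximal ideal of inertia
degree one over `𝔪_{f(P)}` (Mathlib `Ideal.relNorm_eq_pow_of_isMaximal`). [folklore] -/
theorem relNorm_map_incl (hxy : GensIntegral W₁ W₂ L) {a b : F} (h : W₁.Equation a b)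
    (hreg : ∀ r : W₂.CoordinateRing, algebraMap W₂.CoordinateRing L r ∈ localRingAt W₁ L h)
    {a' b' : F} (h' : W₂.Equation a' b')
    (ha : ∃ m ∈ WeierstrassCurve.Affine.CoordinateRing.XYIdeal W₁ a (C b), ∃ d ∈ localRingAt W₁ L h,
      algebraMap W₂.CoordinateRing L (WeierstrassCurve.Affine.CoordinateRing.mk W₂ (C X)) -
        algebraMap F L a' = algebraMap W₁.CoordinateRing L m * d)
    (hb : ∃ m ∈ WeierstrassCurve.Affine.CoordinateRing.XYIdeal W₁ a (C b), ∃ d ∈ localRingAt W₁ L h,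
      algebraMap W₂.CoordinateRing L (WeierstrassCurve.Affine.CoordinateRing.mk W₂ Y) -
        algebraMap F L b' = algebraMap W₁.CoordinateRing L m * d) :
    Ideal.relNorm W₂.CoordinateRing
        ((WeierstrassCurve.Affine.CoordinateRing.XYIdeal W₁ a (C b)).map (incl hxy)) =
      WeierstrassCurve.Affine.CoordinateRing.XYIdeal W₂ a' (C b') := by
  set I := (WeierstrassCurve.Affine.CoordinateRing.XYIdeal W₁ a (C b)).map (incl hxy) with hI
  haveI hImax : I.IsMaximal := isMaximal_map_incl hxy h hreg
  set p : Ideal W₂.CoordinateRing := I.comap (algebraMap W₂.CoordinateRing _) with hp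
  haveI : I.LiesOver p := ⟨rfl⟩
  haveI hpmax : p.IsMaximal := Ideal.isMaximal_comap_of_isIntegral_of_isMaximal I
  -- inertia degree one: every class of `A/I` is the class of a constant
  have hdeg : I.inertiaDeg W₂.CoordinateRing = 1 := by
    rw [Ideal.inertiaDeg_eq_of_isMaximal p I]
    letI := Ideal.Quotient.field p
    haveI : Nontrivial (integralClosure W₂.CoordinateRing L ⧸ I) :=
      Ideal.Quotient.nontrivial_iff.mpr hImax.ne_top
    have hsurj : Function.Surjective
        (algebraMap (W₂.CoordinateRing ⧸ p) (integralClosure W₂.CoordinateRing L ⧸ I)) := by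
      intro q
      obtain ⟨c, hc⟩ := exists_mk_algebraMap_eq hxy h hreg q
      refine ⟨Ideal.Quotient.mk p (algebraMap F _ c), ?_⟩
      rw [Ideal.Quotient.algebraMap_mk_of_liesOver, ← hc]
      congr 1
      exact Subtype.ext (IsScalarTower.algebraMap_apply F W₂.CoordinateRing L c).symm
    have e := LinearEquiv.ofBijective
      (Algebra.linearMap (W₂.CoordinateRing ⧸ p) (integralClosure W₂.CoordinateRing L ⧸ I))
      ⟨(algebraMap (W₂.CoordinateRing ⧸ p) _).injective, hsurj⟩
    rw [← e.finrank_eq, Module.finrank_self]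
  have hN := Ideal.relNorm_eq_pow_of_isMaximal I p
  rw [hdeg, pow_one] at hN
  rw [hN]
  -- `p = 𝔪_{f(P)}`
  symm
  refine (isMaximal_XYIdeal W₂ h').eq_of_le hpmax.ne_top ?_
  rw [WeierstrassCurve.Affine.CoordinateRing.XYIdeal, Ideal.span_le]
  rintro g (rfl | rfl)
  · obtain ⟨m, hm, d, hd, hmd⟩ := ha
    rw [SetLike.mem_coe, hp, Ideal.mem_comap]
    refine mem_map_incl_of_eq_mul hxy h hreg hm hd ?_
    change algebraMap W₂.CoordinateRing L _ = _
    rw [← hmd, XClass_eq, map_sub, ← IsScalarTower.algebraMap_apply]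
  · obtain ⟨m, hm, d, hd, hmd⟩ := hb
    rw [SetLike.mem_coe, hp, Ideal.mem_comap]
    refine mem_map_incl_of_eq_mul hxy h hreg hm hd ?_
    change algebraMap W₂.CoordinateRing L _ = _
    rw [← hmd, YClass_eq, map_sub, ← IsScalarTower.algebraMap_apply]

/-- **Additivity of the point map** (Silverman, *AEC*, Thm. III.4.8, "isogenies are homomorphisms",
here for any rational map regular at the three points, via `φ_*` on ideal classes as in the printed
proof, AEC II.3.7 and III.3.4). If `P + Q = S` in `W₁(F)` (all three affine, regular for `F[W₂] → L`, with values
`f(P), f(Q), f(S)` in the sense of `relNorm_map_incl`) then `f(P) + f(Q) = f(S)` in `W₂(F)`: the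
relation `(α) 𝔪_P 𝔪_Q = (β) 𝔪_S` in `F[W₁]` (Mathlib's `toClass`) extends to `A`, its relative
norm is `(Nα) 𝔪_{f P} 𝔪_{f Q} = (Nβ) 𝔪_{f S}`, and `toClass` is injective on `W₂(F)`. [folklore] -/
theorem some_add_some_eq (hxy : GensIntegral W₁ W₂ L) [DecidableEq F]
    {a₁ b₁ a₂ b₂ a₃ b₃ : F} (h₁ : W₁.Nonsingular a₁ b₁) (h₂ : W₁.Nonsingular a₂ b₂)
    (h₃ : W₁.Nonsingular a₃ b₃)
    (hsum : WeierstrassCurve.Affine.Point.some _ _ h₁ + WeierstrassCurve.Affine.Point.some _ _ h₂ =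
      WeierstrassCurve.Affine.Point.some _ _ h₃)
    (hreg₁ : ∀ r : W₂.CoordinateRing, algebraMap W₂.CoordinateRing L r ∈ localRingAt W₁ L h₁.1)
    (hreg₂ : ∀ r : W₂.CoordinateRing, algebraMap W₂.CoordinateRing L r ∈ localRingAt W₁ L h₂.1)
    (hreg₃ : ∀ r : W₂.CoordinateRing, algebraMap W₂.CoordinateRing L r ∈ localRingAt W₁ L h₃.1)
    {a₁' b₁' a₂' b₂' a₃' b₃' : F} (h₁' : W₂.Nonsingular a₁' b₁') (h₂' : W₂.Nonsingular a₂' b₂')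
    (h₃' : W₂.Nonsingular a₃' b₃')
    (ha₁ : ∃ m ∈ WeierstrassCurve.Affine.CoordinateRing.XYIdeal W₁ a₁ (C b₁),
      ∃ d ∈ localRingAt W₁ L h₁.1,
      algebraMap W₂.CoordinateRing L (WeierstrassCurve.Affine.CoordinateRing.mk W₂ (C X)) -
        algebraMap F L a₁' = algebraMap W₁.CoordinateRing L m * d)
    (hb₁ : ∃ m ∈ WeierstrassCurve.Affine.CoordinateRing.XYIdeal W₁ a₁ (C b₁),
      ∃ d ∈ localRingAt W₁ L h₁.1,
      algebraMap W₂.CoordinateRing L (WeierstrassCurve.Affine.CoordinateRing.mk W₂ Y) -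
        algebraMap F L b₁' = algebraMap W₁.CoordinateRing L m * d)
    (ha₂ : ∃ m ∈ WeierstrassCurve.Affine.CoordinateRing.XYIdeal W₁ a₂ (C b₂),
      ∃ d ∈ localRingAt W₁ L h₂.1,
      algebraMap W₂.CoordinateRing L (WeierstrassCurve.Affine.CoordinateRing.mk W₂ (C X)) -
        algebraMap F L a₂' = algebraMap W₁.CoordinateRing L m * d)
    (hb₂ : ∃ m ∈ WeierstrassCurve.Affine.CoordinateRing.XYIdeal W₁ a₂ (C b₂),
      ∃ d ∈ localRingAt W₁ L h₂.1,
      algebraMap W₂.CoordinateRing L (WeierstrassCurve.Affine.CoordinateRing.mk W₂ Y) -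
        algebraMap F L b₂' = algebraMap W₁.CoordinateRing L m * d)
    (ha₃ : ∃ m ∈ WeierstrassCurve.Affine.CoordinateRing.XYIdeal W₁ a₃ (C b₃),
      ∃ d ∈ localRingAt W₁ L h₃.1,
      algebraMap W₂.CoordinateRing L (WeierstrassCurve.Affine.CoordinateRing.mk W₂ (C X)) -
        algebraMap F L a₃' = algebraMap W₁.CoordinateRing L m * d)
    (hb₃ : ∃ m ∈ WeierstrassCurve.Affine.CoordinateRing.XYIdeal W₁ a₃ (C b₃),
      ∃ d ∈ localRingAt W₁ L h₃.1,
      algebraMap W₂.CoordinateRing L (WeierstrassCurve.Affine.CoordinateRing.mk W₂ Y) -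
        algebraMap F L b₃' = algebraMap W₁.CoordinateRing L m * d) :
    WeierstrassCurve.Affine.Point.some _ _ h₁' + WeierstrassCurve.Affine.Point.some _ _ h₂' =
      WeierstrassCurve.Affine.Point.some _ _ h₃' := by
  have hN₁ := relNorm_map_incl hxy h₁.1 hreg₁ h₁'.1 ha₁ hb₁
  have hN₂ := relNorm_map_incl hxy h₂.1 hreg₂ h₂'.1 ha₂ hb₂
  have hN₃ := relNorm_map_incl hxy h₃.1 hreg₃ h₃'.1 ha₃ hb₃
  -- the class-group relation upstairs
  have hcl := congrArg WeierstrassCurve.Affine.Point.toClass hsum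
  rw [map_add, WeierstrassCurve.Affine.Point.toClass_some, WeierstrassCurve.Affine.Point.toClass_some,
    WeierstrassCurve.Affine.Point.toClass_some] at hcl
  have hmul : ClassGroup.mk W₁.FunctionField
      (WeierstrassCurve.Affine.CoordinateRing.XYIdeal' (W := W₁) h₁ *
        WeierstrassCurve.Affine.CoordinateRing.XYIdeal' (W := W₁) h₂) =
      ClassGroup.mk W₁.FunctionField (WeierstrassCurve.Affine.CoordinateRing.XYIdeal' (W := W₁) h₃) := by
    rw [map_mul]; exact hcl
  obtain ⟨α, β, hα, hβ, hαβ⟩ := (ClassGroup.mk_eq_mk_of_coe_ideal (by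
      rw [Units.val_mul, WeierstrassCurve.Affine.CoordinateRing.XYIdeal'_eq,
        WeierstrassCurve.Affine.CoordinateRing.XYIdeal'_eq, FractionalIdeal.coeIdeal_mul])
    (WeierstrassCurve.Affine.CoordinateRing.XYIdeal'_eq h₃)).mp hmul
  -- extend to `A` and take relative norms down to `F[W₂]`
  have hrel := congrArg (fun J : Ideal W₁.CoordinateRing =>
    Ideal.relNorm W₂.CoordinateRing (J.map (incl hxy))) hαβ
  simp only [Ideal.map_mul, map_mul, relNorm_map_incl_span_singleton, hN₁, hN₂, hN₃] at hrel
  -- the class-group relation downstairs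
  have hmul' : ClassGroup.mk W₂.FunctionField
      (WeierstrassCurve.Affine.CoordinateRing.XYIdeal' (W := W₂) h₁' *
        WeierstrassCurve.Affine.CoordinateRing.XYIdeal' (W := W₂) h₂') =
      ClassGroup.mk W₂.FunctionField
        (WeierstrassCurve.Affine.CoordinateRing.XYIdeal' (W := W₂) h₃') :=
    (ClassGroup.mk_eq_mk_of_coe_ideal (by
      rw [Units.val_mul, WeierstrassCurve.Affine.CoordinateRing.XYIdeal'_eq,
        WeierstrassCurve.Affine.CoordinateRing.XYIdeal'_eq, FractionalIdeal.coeIdeal_mul])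
      (WeierstrassCurve.Affine.CoordinateRing.XYIdeal'_eq h₃')).mpr
      ⟨_, _, intNorm_incl_ne_zero hxy hα, intNorm_incl_ne_zero hxy hβ, hrel⟩
  apply WeierstrassCurve.Affine.Point.toClass_injective
  rw [map_add, WeierstrassCurve.Affine.Point.toClass_some, WeierstrassCurve.Affine.Point.toClass_some,
    WeierstrassCurve.Affine.Point.toClass_some]
  rw [map_mul] at hmul'
  exact hmul'

end Norm

end Literature.NumberTheory.EllipticCurves.RationalMapHom

/-! ## Explicit rational maps in standard form -/

namespace WeierstrassCurve

/-- **An explicit isogeny formula** between Weierstrass curves `W₁ → W₂` over a commutative ring `R`: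
polynomials `U, h, S, T ∈ R[X]` describing the rational map
`(x, y) ↦ (U(x)/h(x)², (S(x)·y + T(x))/h(x)³)` (the standard form of an isogeny with kernel
polynomial `h`, cf. Vélu's formulae, Silverman, *AEC*, Remark III.4.13.3), subject to
* the **curve identity**: substituting into the equation of `W₂` and multiplying by `h⁶` gives
  `S² · (equation of W₁)` in `R[X][Y]`; since the equation of `W₁` is monic quadratic in `Y` this is
  the pair of identities `identity₁` (coefficient of `Y`) and `identity₀` (constant coefficient);
* the **degree condition** `deg h² < deg U` (the map sends `O ↦ O`; for an isogeny of degree `ℓ`,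
  `deg U = ℓ` and `deg h² = ℓ - 1`).
No condition relating the roots of `h` to a subgroup is imposed: the theorem `toIsogeny` below
produces an isogeny from these data alone (AEC III.4.8: a rational map `O ↦ O` is a homomorphism).
[cite: SilvermanAEC2009, Thm. III.4.8 (PDF p. 70) and Remarks III.4.13.2–4.13.3 (PDF p. 73)] -/
structure IsogenyFormula {R : Type*} [CommRing R] (W₁ W₂ : WeierstrassCurve R) where
  /-- Numerator of the `x`-coordinate map `x ↦ U(x)/h(x)²`. -/
  U : R[X]
  /-- The denominator polynomial (kernel polynomial) `h`. -/
  h : R[X]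
  /-- The `y`-coordinate map is `(S(x) y + T(x))/h(x)³`. -/
  S : R[X]
  /-- The `y`-coordinate map is `(S(x) y + T(x))/h(x)³`. -/
  T : R[X]
  /-- The coefficient of `Y` in `h⁶ · W₂(U/h², (SY+T)/h³) = S² · W₁(X, Y)`. -/
  identity₁ : 2 * S * T + (C W₂.a₁ * U * h + C W₂.a₃ * h ^ 3) * S =
    S ^ 2 * (C W₁.a₁ * X + C W₁.a₃)
  /-- The constant coefficient in `h⁶ · W₂(U/h², (SY+T)/h³) = S² · W₁(X, Y)`. -/
  identity₀ : T ^ 2 + (C W₂.a₁ * U * h + C W₂.a₃ * h ^ 3) * T -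
      (U ^ 3 + C W₂.a₂ * U ^ 2 * h ^ 2 + C W₂.a₄ * U * h ^ 4 + C W₂.a₆ * h ^ 6) =
    -(S ^ 2 * (X ^ 3 + C W₁.a₂ * X ^ 2 + C W₁.a₄ * X + C W₁.a₆))
  /-- `h ≠ 0`. -/
  h_ne_zero : h ≠ 0
  /-- `deg h² < deg U` (so `x ↦ U/h²` has a pole at `∞`, i.e. `O ↦ O`). -/
  natDegree_lt : (h ^ 2).natDegree < U.natDegree

namespace IsogenyFormula

section Map

variable {R : Type*} {A : Type*} [CommRing R] [CommRing A] {W₁ W₂ : WeierstrassCurve R}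

/-- Base change of an isogeny formula along an injective ring map. [folklore] -/
def map (φ : IsogenyFormula W₁ W₂) (f : R →+* A) (hf : Function.Injective f) :
    IsogenyFormula (W₁.map f) (W₂.map f) where
  U := φ.U.map f
  h := φ.h.map f
  S := φ.S.map f
  T := φ.T.map f
  identity₁ := by
    simpa only [Polynomial.map_add, Polynomial.map_mul, Polynomial.map_pow, Polynomial.map_sub,
      Polynomial.map_neg, Polynomial.map_ofNat, map_C, map_X, map_a₁, map_a₃] using
      congrArg (Polynomial.map f) φ.identity₁
  identity₀ := by
    simpa only [Polynomial.map_add, Polynomial.map_mul, Polynomial.map_pow, Polynomial.map_sub,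
      Polynomial.map_neg, Polynomial.map_ofNat, map_C, map_X, map_a₁, map_a₂, map_a₃, map_a₄,
      map_a₆] using congrArg (Polynomial.map f) φ.identity₀
  h_ne_zero := by
    rw [Ne, Polynomial.map_eq_zero_iff hf]
    exact φ.h_ne_zero
  natDegree_lt := by
    rw [← Polynomial.map_pow, natDegree_map_eq_of_injective hf, natDegree_map_eq_of_injective hf]
    exact φ.natDegree_lt

/-- The data of a base-changed formula. [folklore] -/
@[simp] theorem map_U (φ : IsogenyFormula W₁ W₂) (f : R →+* A) (hf : Function.Injective f) :
    (φ.map f hf).U = φ.U.map f := rfl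
/-- The data of a base-changed formula. [folklore] -/
@[simp] theorem map_h (φ : IsogenyFormula W₁ W₂) (f : R →+* A) (hf : Function.Injective f) :
    (φ.map f hf).h = φ.h.map f := rfl
/-- The data of a base-changed formula. [folklore] -/
@[simp] theorem map_S (φ : IsogenyFormula W₁ W₂) (f : R →+* A) (hf : Function.Injective f) :
    (φ.map f hf).S = φ.S.map f := rfl
/-- The data of a base-changed formula. [folklore] -/
@[simp] theorem map_T (φ : IsogenyFormula W₁ W₂) (f : R →+* A) (hf : Function.Injective f) :
    (φ.map f hf).T = φ.T.map f := rfl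

end Map

section Field

variable {F : Type u} [Field F] {W₁ W₂ : WeierstrassCurve F}

/-- `U ≠ 0`. [folklore] -/
theorem U_ne_zero (φ : IsogenyFormula W₁ W₂) : φ.U ≠ 0 := by
  intro h0
  have := φ.natDegree_lt
  rw [h0, natDegree_zero] at this
  exact Nat.not_lt_zero _ this

/-- **The algebraic identity at a point.** If `(a, b) ∈ W₁(K)` and `h(a) ≠ 0` then
`(U(a)/h(a)², (S(a) b + T(a))/h(a)³) ∈ W₂(K)`, for any field `K` over which the formula is read.
[folklore] -/
theorem equation_of_eval {K : Type*} [Field K] {A₁ A₂ A₃ A₄ A₆ B₁ B₂ B₃ B₄ B₆ a b u v s t : K}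
    (hv : v ≠ 0) (hW : b ^ 2 + B₁ * a * b + B₃ * b = a ^ 3 + B₂ * a ^ 2 + B₄ * a + B₆)
    (h1 : 2 * s * t + (A₁ * u * v + A₃ * v ^ 3) * s = s ^ 2 * (B₁ * a + B₃))
    (h0 : t ^ 2 + (A₁ * u * v + A₃ * v ^ 3) * t - (u ^ 3 + A₂ * u ^ 2 * v ^ 2 + A₄ * u * v ^ 4 +
      A₆ * v ^ 6) = -(s ^ 2 * (a ^ 3 + B₂ * a ^ 2 + B₄ * a + B₆))) :
    ((s * b + t) / v ^ 3) ^ 2 + A₁ * (u / v ^ 2) * ((s * b + t) / v ^ 3) + A₃ * ((s * b + t) / v ^ 3)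
      = (u / v ^ 2) ^ 3 + A₂ * (u / v ^ 2) ^ 2 + A₄ * (u / v ^ 2) + A₆ := by
  have key : (s * b + t) ^ 2 + A₁ * u * v * (s * b + t) + A₃ * v ^ 3 * (s * b + t) -
      (u ^ 3 + A₂ * u ^ 2 * v ^ 2 + A₄ * u * v ^ 4 + A₆ * v ^ 6) = 0 := by
    linear_combination b * h1 + h0 + s ^ 2 * hW
  rw [← sub_eq_zero]
  have : ((s * b + t) / v ^ 3) ^ 2 + A₁ * (u / v ^ 2) * ((s * b + t) / v ^ 3) +
      A₃ * ((s * b + t) / v ^ 3) - ((u / v ^ 2) ^ 3 + A₂ * (u / v ^ 2) ^ 2 + A₄ * (u / v ^ 2) + A₆) =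
      ((s * b + t) ^ 2 + A₁ * u * v * (s * b + t) + A₃ * v ^ 3 * (s * b + t) -
      (u ^ 3 + A₂ * u ^ 2 * v ^ 2 + A₄ * u * v ^ 4 + A₆ * v ^ 6)) / v ^ 6 := by
    field_simp
  rw [this, key, zero_div]

variable (φ : IsogenyFormula W₁ W₂)

/-- The identities evaluated at `a ∈ K` along a ring map `f : F → K`. [folklore] -/
theorem identity₁_eval₂ {K : Type*} [CommRing K] (f : F →+* K) (a : K) :
    2 * φ.S.eval₂ f a * φ.T.eval₂ f a +
      (f W₂.a₁ * φ.U.eval₂ f a * φ.h.eval₂ f a + f W₂.a₃ * φ.h.eval₂ f a ^ 3) * φ.S.eval₂ f a =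
    φ.S.eval₂ f a ^ 2 * (f W₁.a₁ * a + f W₁.a₃) := by
  simpa only [eval₂_add, eval₂_mul, eval₂_pow, eval₂_C, eval₂_X, eval₂_ofNat] using
    congrArg (Polynomial.eval₂ f a) φ.identity₁

/-- The constant-coefficient identity evaluated at `a ∈ K` along a ring map `f : F → K`. [folklore] -/
theorem identity₀_eval₂ {K : Type*} [CommRing K] (f : F →+* K) (a : K) :
    φ.T.eval₂ f a ^ 2 +
      (f W₂.a₁ * φ.U.eval₂ f a * φ.h.eval₂ f a + f W₂.a₃ * φ.h.eval₂ f a ^ 3) * φ.T.eval₂ f a -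
      (φ.U.eval₂ f a ^ 3 + f W₂.a₂ * φ.U.eval₂ f a ^ 2 * φ.h.eval₂ f a ^ 2 +
        f W₂.a₄ * φ.U.eval₂ f a * φ.h.eval₂ f a ^ 4 + f W₂.a₆ * φ.h.eval₂ f a ^ 6) =
    -(φ.S.eval₂ f a ^ 2 * (a ^ 3 + f W₁.a₂ * a ^ 2 + f W₁.a₄ * a + f W₁.a₆)) := by
  simpa only [eval₂_add, eval₂_mul, eval₂_pow, eval₂_C, eval₂_X, eval₂_ofNat, eval₂_sub,
    eval₂_neg] using congrArg (Polynomial.eval₂ f a) φ.identity₀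

/-- The coordinates of the image of an affine point `(a, b)` with `h(a) ≠ 0`. [folklore] -/
def valX (a : F) : F := φ.U.eval a / φ.h.eval a ^ 2

/-- The coordinates of the image of an affine point `(a, b)` with `h(a) ≠ 0`. [folklore] -/
def valY (a b : F) : F := (φ.S.eval a * b + φ.T.eval a) / φ.h.eval a ^ 3

/-- The image of a point of `W₁` off `h = 0` lies on `W₂`. [folklore] -/
theorem equation_val {a b : F} (hab : W₁.toAffine.Equation a b) (ha : φ.h.eval a ≠ 0) :
    W₂.toAffine.Equation (φ.valX a) (φ.valY a b) := by
  rw [WeierstrassCurve.Affine.equation_iff] at hab ⊢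
  unfold valX valY
  have h1 := φ.identity₁_eval₂ (RingHom.id F) a
  have h0 := φ.identity₀_eval₂ (RingHom.id F) a
  simp only [eval₂_id, RingHom.id_apply] at h1 h0
  have := equation_of_eval (A₂ := W₂.a₂) (A₄ := W₂.a₄) (A₆ := W₂.a₆) ha hab h1 h0
  linear_combination this

/-- The image of a point of `W₁` off `h = 0` is a nonsingular point of `W₂` (elliptic). [folklore] -/
theorem nonsingular_val [W₂.IsElliptic] {a b : F} (hab : W₁.toAffine.Equation a b)
    (ha : φ.h.eval a ≠ 0) : W₂.toAffine.Nonsingular (φ.valX a) (φ.valY a b) :=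
  (WeierstrassCurve.Affine.equation_iff_nonsingular_of_Δ_ne_zero
    (W₂.coe_Δ' ▸ W₂.Δ'.ne_zero)).mp (φ.equation_val hab ha)

variable [DecidableEq F]

/-- **The point map** of an isogeny formula on `F`-points: `O ↦ O`, the affine points with
`h(x) = 0` go to `O` (a provisional value: the genuine isogeny `toIsogeny` may differ there), and
`(a, b) ↦ (U(a)/h(a)², (S(a) b + T(a))/h(a)³)` otherwise. [folklore] -/
def pointFun [W₂.IsElliptic] : W₁.toAffine.Point → W₂.toAffine.Point
  | 0 => 0
  | WeierstrassCurve.Affine.Point.some a b hab =>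
    if ha : φ.h.eval a = 0 then 0
    else WeierstrassCurve.Affine.Point.some (φ.valX a) (φ.valY a b) (φ.nonsingular_val hab.1 ha)

/-- `O ↦ O`. [folklore] -/
@[simp] theorem pointFun_zero [W₂.IsElliptic] : φ.pointFun 0 = 0 := rfl

/-- The provisional value `O` at the affine points with `h(x) = 0`. [folklore] -/
theorem pointFun_some_of_eval_eq_zero [W₂.IsElliptic] {a b : F} (hab : W₁.toAffine.Nonsingular a b)
    (ha : φ.h.eval a = 0) : φ.pointFun (WeierstrassCurve.Affine.Point.some _ _ hab) = 0 := by
  simp [pointFun, ha]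

/-- The value of the point map at an affine point with `h(x) ≠ 0`. [folklore] -/
theorem pointFun_some [W₂.IsElliptic] {a b : F} (hab : W₁.toAffine.Nonsingular a b)
    (ha : φ.h.eval a ≠ 0) : φ.pointFun (WeierstrassCurve.Affine.Point.some _ _ hab) =
      WeierstrassCurve.Affine.Point.some _ _ (φ.nonsingular_val hab.1 ha) := by
  simp [pointFun, ha]

end Field

/-! ### The function-field side: `ψ : F[W₂] → L = F(W₁)` -/

section FunctionField

variable {F : Type u} [Field F] (W₁ : WeierstrassCurve F) {W₂ : WeierstrassCurve F}
variable (L : Type v) [Field L] [Algebra W₁.toAffine.CoordinateRing L]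

/-- `p ↦ p(x₁) ∈ L`: the composite `F[X] → F[W₁] → L`. [folklore] -/
def toL : F[X] →+* L :=
  (algebraMap W₁.toAffine.CoordinateRing L).comp (algebraMap F[X] W₁.toAffine.CoordinateRing)

/-- `x₁ ∈ L`. [folklore] -/
def xL : L := algebraMap W₁.toAffine.CoordinateRing L
  (WeierstrassCurve.Affine.CoordinateRing.mk W₁.toAffine (C X))

/-- `y₁ ∈ L`. [folklore] -/
def yL : L := algebraMap W₁.toAffine.CoordinateRing L
  (WeierstrassCurve.Affine.CoordinateRing.mk W₁.toAffine Y)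

/-- Unfolding `toL`. [folklore] -/
theorem toL_apply (p : F[X]) : toL W₁ L p =
    algebraMap W₁.toAffine.CoordinateRing L (algebraMap F[X] W₁.toAffine.CoordinateRing p) := rfl

/-- `toL X = x₁`. [folklore] -/
@[simp] theorem toL_X : toL W₁ L X = xL W₁ L := rfl

section Inj

variable [IsFractionRing W₁.toAffine.CoordinateRing L]

/-- `F[X] → L` is injective (`x₁` is transcendental over `F`). [folklore] -/
theorem toL_injective : Function.Injective (toL W₁ L) :=
  (IsFractionRing.injective W₁.toAffine.CoordinateRing L).comp
    (Literature.NumberTheory.EllipticCurves.WeierstrassCoordinateRing.algebraMap_injective W₁.toAffine)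

variable {W₁} (φ : IsogenyFormula W₁ W₂)

/-- `h(x₁) ≠ 0` in `L`. [folklore] -/
theorem toL_h_ne_zero : toL W₁ L φ.h ≠ 0 :=
  (map_ne_zero_iff _ (toL_injective W₁ L)).mpr φ.h_ne_zero

/-- `x' = U(x₁)/h(x₁)² ∈ L`, the pull-back of `x₂`. [folklore] -/
def x' : L := toL W₁ L φ.U / toL W₁ L φ.h ^ 2

/-- `y' = (S(x₁) y₁ + T(x₁))/h(x₁)³ ∈ L`, the pull-back of `y₂`. [folklore] -/
def y' : L := (toL W₁ L φ.S * yL W₁ L + toL W₁ L φ.T) / toL W₁ L φ.h ^ 3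

end Inj

variable [Algebra F L] [IsScalarTower F W₁.toAffine.CoordinateRing L]

/-- `toL` on constants. [folklore] -/
@[simp] theorem toL_C (c : F) : toL W₁ L (C c) = algebraMap F L c := by
  rw [toL_apply, show C c = algebraMap F F[X] c from rfl,
    ← IsScalarTower.algebraMap_apply F F[X] W₁.toAffine.CoordinateRing,
    ← IsScalarTower.algebraMap_apply F W₁.toAffine.CoordinateRing L]

/-- `toL = aeval x₁`. [folklore] -/
theorem toL_eq_aeval (p : F[X]) : toL W₁ L p = aeval (xL W₁ L) p := by
  have : toL W₁ L = (aeval (R := F) (xL W₁ L) : F[X] →ₐ[F] L).toRingHom := by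
    apply Polynomial.ringHom_ext
    · intro c
      rw [toL_C, AlgHom.toRingHom_eq_coe, RingHom.coe_coe, aeval_C]
    · rw [toL_X, AlgHom.toRingHom_eq_coe, RingHom.coe_coe, aeval_X]
  exact congrArg (fun f : F[X] →+* L => f p) this

/-- `p(x₁)` computed by `eval₂`. [folklore] -/
theorem eval₂_xL (p : F[X]) : p.eval₂ (algebraMap F L) (xL W₁ L) = toL W₁ L p := by
  rw [toL_eq_aeval]; rfl

/-- The Weierstrass relation between `x₁, y₁` in `L`. [folklore] -/
theorem weierstrass_xL_yL :
    yL W₁ L ^ 2 + algebraMap F L W₁.a₁ * xL W₁ L * yL W₁ L + algebraMap F L W₁.a₃ * yL W₁ L =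
      xL W₁ L ^ 3 + algebraMap F L W₁.a₂ * xL W₁ L ^ 2 + algebraMap F L W₁.a₄ * xL W₁ L +
        algebraMap F L W₁.a₆ := by
  have h0 := AdjoinRoot.eval₂_root W₁.toAffine.polynomial
  have h1 := congrArg (algebraMap W₁.toAffine.CoordinateRing L) h0
  rw [map_zero, Polynomial.hom_eval₂] at h1
  have hc : ((algebraMap W₁.toAffine.CoordinateRing L).comp (AdjoinRoot.of W₁.toAffine.polynomial)) =
      toL W₁ L := rfl
  have hr : algebraMap W₁.toAffine.CoordinateRing L (AdjoinRoot.root W₁.toAffine.polynomial) =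
      yL W₁ L := rfl
  rw [hc, hr, WeierstrassCurve.Affine.polynomial] at h1
  simp only [eval₂_add, eval₂_sub, eval₂_mul, eval₂_pow, eval₂_C, eval₂_X, map_add, map_mul,
    map_pow, toL_C, toL_X] at h1
  linear_combination h1

variable [IsFractionRing W₁.toAffine.CoordinateRing L] {W₁} (φ : IsogenyFormula W₁ W₂)

/-- `(x', y')` satisfies the equation of `W₂` in `L` (the curve identity). [folklore] -/
theorem equation_x'_y' :
    φ.y' L ^ 2 + algebraMap F L W₂.a₁ * φ.x' L * φ.y' L + algebraMap F L W₂.a₃ * φ.y' L =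
      φ.x' L ^ 3 + algebraMap F L W₂.a₂ * φ.x' L ^ 2 + algebraMap F L W₂.a₄ * φ.x' L +
        algebraMap F L W₂.a₆ := by
  have h1 := φ.identity₁_eval₂ (algebraMap F L) (xL W₁ L)
  have h0 := φ.identity₀_eval₂ (algebraMap F L) (xL W₁ L)
  simp only [eval₂_xL] at h1 h0
  exact equation_of_eval (toL_h_ne_zero L φ) (weierstrass_xL_yL W₁ L) h1 h0

/-- **The pull-back** `ψ : F[W₂] → L`, `x₂ ↦ x'`, `y₂ ↦ y'` (well defined by the curve identity).
[folklore] -/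
def psi : W₂.toAffine.CoordinateRing →+* L :=
  AdjoinRoot.lift (Polynomial.eval₂RingHom (algebraMap F L) (φ.x' L)) (φ.y' L) (by
    rw [WeierstrassCurve.Affine.polynomial]
    simp only [eval₂_add, eval₂_sub, eval₂_mul, eval₂_pow, eval₂_C, eval₂_X,
      Polynomial.coe_eval₂RingHom]
    linear_combination φ.equation_x'_y' L)

/-- `ψ(x₂) = x'`. [folklore] -/
@[simp] theorem psi_mk_C_X :
    φ.psi L (WeierstrassCurve.Affine.CoordinateRing.mk W₂.toAffine (C X)) = φ.x' L := by
  rw [psi, AdjoinRoot.mk_C, AdjoinRoot.lift_of, Polynomial.coe_eval₂RingHom, eval₂_X]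

/-- `ψ(y₂) = y'`. [folklore] -/
@[simp] theorem psi_mk_Y :
    φ.psi L (WeierstrassCurve.Affine.CoordinateRing.mk W₂.toAffine Y) = φ.y' L :=
  AdjoinRoot.lift_root _

/-- `ψ(p(x₂)) = p(x')`. [folklore] -/
theorem psi_algebraMap_polynomial (p : F[X]) :
    φ.psi L (algebraMap F[X] W₂.toAffine.CoordinateRing p) = p.eval₂ (algebraMap F L) (φ.x' L) := by
  rw [AdjoinRoot.algebraMap_eq, psi, AdjoinRoot.lift_of, Polynomial.coe_eval₂RingHom]

/-- `ψ` fixes the constants. [folklore] -/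
@[simp] theorem psi_algebraMap (c : F) :
    φ.psi L (algebraMap F W₂.toAffine.CoordinateRing c) = algebraMap F L c := by
  rw [IsScalarTower.algebraMap_apply F F[X] W₂.toAffine.CoordinateRing, psi_algebraMap_polynomial,
    show algebraMap F F[X] c = C c from rfl, eval₂_C]

/-- `ψ` is an `F`-algebra map. [folklore] -/
theorem isScalarTower_psi : letI := (φ.psi L).toAlgebra;
    IsScalarTower F W₂.toAffine.CoordinateRing L :=
  letI := (φ.psi L).toAlgebra
  IsScalarTower.of_algebraMap_eq fun c => (φ.psi_algebraMap L c).symm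

/-! #### `x₁, y₁` are integral over `F[W₂]` -/

/-- `x₁` is a root of the polynomial `lc(U)⁻¹ (U(Z) - x₂ h(Z)²) ∈ F[W₂][Z]`, monic because
`deg h² < deg U`. [folklore] -/
theorem isIntegral_xL : letI := (φ.psi L).toAlgebra;
    _root_.IsIntegral W₂.toAffine.CoordinateRing (xL W₁ L) := by
  letI := (φ.psi L).toAlgebra
  haveI := φ.isScalarTower_psi L
  set f := algebraMap F W₂.toAffine.CoordinateRing with hf
  have hfi : Function.Injective f := f.injective
  set Q : W₂.toAffine.CoordinateRing[X] :=
    φ.U.map f - C (WeierstrassCurve.Affine.CoordinateRing.mk W₂.toAffine (C X)) * (φ.h ^ 2).map f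
    with hQ
  have hdeg : ((C (WeierstrassCurve.Affine.CoordinateRing.mk W₂.toAffine (C X)) *
      (φ.h ^ 2).map f)).degree < (φ.U.map f).degree := by
    refine (degree_mul_le _ _).trans_lt ?_
    refine (add_le_of_nonpos_left degree_C_le).trans_lt ?_
    rw [degree_map_eq_of_injective hfi, degree_map_eq_of_injective hfi]
    exact degree_lt_degree φ.natDegree_lt
  have hlc : Q.leadingCoeff = f φ.U.leadingCoeff := by
    rw [hQ, leadingCoeff_sub_of_degree_lt hdeg, leadingCoeff_map_of_injective hfi]
  have hlc0 : φ.U.leadingCoeff ≠ 0 := leadingCoeff_ne_zero.mpr φ.U_ne_zero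
  refine ⟨C (f φ.U.leadingCoeff⁻¹) * Q, ?_, ?_⟩
  · rw [Monic, leadingCoeff_mul, leadingCoeff_C, hlc, ← map_mul, inv_mul_cancel₀ hlc0, map_one]
  · have h1 : (φ.U.map f).eval₂ (algebraMap W₂.toAffine.CoordinateRing L) (xL W₁ L) =
        toL W₁ L φ.U := by
      rw [eval₂_map, hf, ← IsScalarTower.algebraMap_eq, eval₂_xL]
    have h2 : ((φ.h ^ 2).map f).eval₂ (algebraMap W₂.toAffine.CoordinateRing L) (xL W₁ L) =
        toL W₁ L φ.h ^ 2 := by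
      rw [eval₂_map, hf, ← IsScalarTower.algebraMap_eq, eval₂_xL, map_pow]
    rw [eval₂_mul, eval₂_C, hQ, eval₂_sub, eval₂_mul, eval₂_C, h1, h2,
      RingHom.algebraMap_toAlgebra, psi_mk_C_X, x',
      div_mul_cancel₀ _ (pow_ne_zero 2 (toL_h_ne_zero L φ)), sub_self, mul_zero]

/-- `y₁` is integral over `F[W₂]`: it is a root of the (monic quadratic) Weierstrass equation, whose
coefficients are polynomials in `x₁`, hence integral. [folklore] -/
theorem isIntegral_yL : letI := (φ.psi L).toAlgebra;
    _root_.IsIntegral W₂.toAffine.CoordinateRing (yL W₁ L) := by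
  letI := (φ.psi L).toAlgebra
  haveI := φ.isScalarTower_psi L
  set A := integralClosure W₂.toAffine.CoordinateRing L
  have hx : xL W₁ L ∈ A := φ.isIntegral_xL L
  have hc : ∀ c : F, algebraMap F L c ∈ A := fun c => by
    rw [IsScalarTower.algebraMap_apply F W₂.toAffine.CoordinateRing L c]
    exact Subalgebra.algebraMap_mem _ _
  set b : L := algebraMap F L W₁.a₁ * xL W₁ L + algebraMap F L W₁.a₃ with hb
  set c : L := xL W₁ L ^ 3 + algebraMap F L W₁.a₂ * xL W₁ L ^ 2 + algebraMap F L W₁.a₄ * xL W₁ L +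
    algebraMap F L W₁.a₆ with hcdef
  have hbA : b ∈ A := add_mem (mul_mem (hc _) hx) (hc _)
  have hcA : c ∈ A :=
    add_mem (add_mem (add_mem (pow_mem hx 3) (mul_mem (hc _) (pow_mem hx 2))) (mul_mem (hc _) hx))
      (hc _)
  have hint : _root_.IsIntegral A (yL W₁ L) := by
    refine ⟨X ^ 2 + (C (⟨b, hbA⟩ : A) * X - C (⟨c, hcA⟩ : A)), monic_X_pow_add ?_, ?_⟩
    · refine (degree_sub_le _ _).trans_lt (max_lt ?_ ?_)
      · exact (degree_C_mul_X_le _).trans_lt (by exact_mod_cast Nat.lt_succ_self 1)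
      · exact degree_C_le.trans_lt (by exact_mod_cast Nat.succ_pos 1)
    · simp only [eval₂_add, eval₂_sub, eval₂_mul, eval₂_pow, eval₂_C, eval₂_X]
      change yL W₁ L ^ 2 + (b * yL W₁ L - c) = 0
      rw [hb, hcdef]
      linear_combination weierstrass_xL_yL W₁ L
  exact isIntegral_trans _ hint

/-- The generators of `F[W₁]` are integral over `F[W₂]` (via `ψ`). [folklore] -/
theorem gensIntegral : letI := (φ.psi L).toAlgebra;
    Literature.NumberTheory.EllipticCurves.RationalMapHom.GensIntegral W₁.toAffine W₂.toAffine L :=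
  letI := (φ.psi L).toAlgebra
  ⟨φ.isIntegral_xL L, φ.isIntegral_yL L⟩

/-! #### `ψ` is injective (`x'` is transcendental over `F`) -/

/-- `q(x') ≠ 0` for `q ≠ 0`: clearing denominators, `h(x₁)^{2n} q(x') = Q(x₁)` for a polynomial
`Q` whose coefficient in degree `n · deg U` is `lc(q) lc(U)ⁿ ≠ 0` (here `deg h² < deg U` is used),
and `x₁` is transcendental over `F`. [folklore] -/
theorem eval₂_x'_ne_zero {q : F[X]} (hq0 : q ≠ 0) : q.eval₂ (algebraMap F L) (φ.x' L) ≠ 0 := by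
  intro hq
  set n := q.natDegree with hn
  set d := φ.U.natDegree with hd
  set e := (φ.h ^ 2).natDegree with he
  have hv : toL W₁ L φ.h ^ 2 ≠ 0 := pow_ne_zero 2 (toL_h_ne_zero L φ)
  set Q : F[X] := ∑ k ∈ Finset.range (n + 1), C (q.coeff k) * φ.U ^ k * (φ.h ^ 2) ^ (n - k)
    with hQ
  -- `Q(x₁) = h(x₁)^{2n} q(x')`
  have hQL : toL W₁ L Q = (toL W₁ L φ.h ^ 2) ^ n * q.eval₂ (algebraMap F L) (φ.x' L) := by
    rw [eval₂_eq_sum_range, Finset.mul_sum, hQ, map_sum]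
    refine Finset.sum_congr rfl fun k hk => ?_
    rw [Finset.mem_range_succ_iff] at hk
    have hsplit : (toL W₁ L φ.h ^ 2) ^ n = (toL W₁ L φ.h ^ 2) ^ k * (toL W₁ L φ.h ^ 2) ^ (n - k) := by
      rw [← pow_add, Nat.add_sub_cancel' hk]
    rw [map_mul, map_mul, map_pow, map_pow, map_pow, toL_C, x', div_pow, hsplit]
    field_simp
  rw [hq, mul_zero] at hQL
  have hQ0 : Q = 0 := (map_eq_zero_iff _ (toL_injective W₁ L)).mp hQL
  -- but the coefficient of `Q` in degree `n d` is `lc(q) lc(U)^n ≠ 0`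
  have hed : e < d := φ.natDegree_lt
  have hcoeff : Q.coeff (n * d) = q.leadingCoeff * φ.U.leadingCoeff ^ n := by
    rw [hQ, finsetSum_coeff, Finset.sum_eq_single_of_mem n (Finset.self_mem_range_succ n)]
    · rw [Nat.sub_self, pow_zero, mul_one, coeff_C_mul, hd, coeff_pow_mul_natDegree]
      rfl
    · intro k hk hkn
      rw [Finset.mem_range_succ_iff] at hk
      have hlt : k < n := lt_of_le_of_ne hk hkn
      apply coeff_eq_zero_of_natDegree_lt
      calc (C (q.coeff k) * φ.U ^ k * (φ.h ^ 2) ^ (n - k)).natDegree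
          ≤ (C (q.coeff k) * φ.U ^ k).natDegree + ((φ.h ^ 2) ^ (n - k)).natDegree :=
            natDegree_mul_le
        _ ≤ (0 + k * d) + (n - k) * e := by
            gcongr
            · exact natDegree_mul_le.trans (add_le_add (natDegree_C _).le natDegree_pow_le)
            · exact natDegree_pow_le
        _ < k * d + (n - k) * d := by
            rw [zero_add]
            gcongr
            · exact Nat.sub_pos_of_lt hlt
        _ = n * d := by rw [← add_mul, Nat.add_sub_cancel' hk]
  have : q.leadingCoeff * φ.U.leadingCoeff ^ n ≠ 0 :=
    mul_ne_zero (leadingCoeff_ne_zero.mpr hq0) (pow_ne_zero _ (leadingCoeff_ne_zero.mpr φ.U_ne_zero))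
  rw [← hcoeff, hQ0, coeff_zero] at this
  exact this rfl

/-- **`ψ : F[W₂] → F(W₁)` is injective** (the rational map is dominant): its kernel is a prime of
`F[W₂]` meeting `F[X]` trivially (`x'` is transcendental), hence zero since `F[W₂]` is integral
over `F[X]`. [folklore] -/
theorem psi_injective : Function.Injective (φ.psi L) := by
  rw [injective_iff_map_eq_zero]
  intro r hr
  by_contra hr0
  have hker : RingHom.ker (φ.psi L) ≠ ⊥ := by
    intro hbot
    apply hr0
    have : r ∈ RingHom.ker (φ.psi L) := hr
    rwa [hbot, Ideal.mem_bot] at this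
  have hcomap : (RingHom.ker (φ.psi L)).comap (algebraMap F[X] W₂.toAffine.CoordinateRing) ≠ ⊥ :=
    fun hbot => hker (Ideal.eq_bot_of_comap_eq_bot hbot)
  obtain ⟨q, hq, hq0⟩ := Submodule.exists_mem_ne_zero_of_ne_bot hcomap
  rw [Ideal.mem_comap, RingHom.mem_ker, psi_algebraMap_polynomial] at hq
  exact φ.eval₂_x'_ne_zero L hq0 hq

/-- `L` is a faithful (torsion-free) `F[W₂]`-algebra via `ψ`. [folklore] -/
theorem faithfulSMul_psi : letI := (φ.psi L).toAlgebra;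
    FaithfulSMul W₂.toAffine.CoordinateRing L :=
  letI := (φ.psi L).toAlgebra
  (faithfulSMul_iff_algebraMap_injective _ L).mpr (φ.psi_injective L)

/-! #### The extension `F(W₂) → L` is finite (so the integral closure is Dedekind and finite) -/

/-- The field embedding `F(W₂) → L` extending `ψ`. [folklore] -/
def psiField : W₂.toAffine.FunctionField →+* L :=
  IsFractionRing.lift (K := W₂.toAffine.FunctionField) (φ.psi_injective L)

/-- The field embedding extends `ψ`. [folklore] -/
theorem psiField_algebraMap (r : W₂.toAffine.CoordinateRing) :
    φ.psiField L (algebraMap _ W₂.toAffine.FunctionField r) = φ.psi L r :=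
  IsFractionRing.lift_algebraMap _ r

/-- The scalar towers for `F → F[W₂] → F(W₂) → L`. [folklore] -/
theorem isScalarTower_psiField : letI := (φ.psi L).toAlgebra; letI := (φ.psiField L).toAlgebra;
    IsScalarTower W₂.toAffine.CoordinateRing W₂.toAffine.FunctionField L :=
  letI := (φ.psi L).toAlgebra
  letI := (φ.psiField L).toAlgebra
  IsScalarTower.of_algebraMap_eq fun r => (φ.psiField_algebraMap L r).symm

/-- The field embedding fixes the constants. [folklore] -/
theorem isScalarTower_psiField' : letI := (φ.psiField L).toAlgebra;
    IsScalarTower F W₂.toAffine.FunctionField L :=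
  letI := (φ.psiField L).toAlgebra
  IsScalarTower.of_algebraMap_eq fun c => by
    rw [RingHom.algebraMap_toAlgebra, IsScalarTower.algebraMap_apply F W₂.toAffine.CoordinateRing
      W₂.toAffine.FunctionField, psiField_algebraMap, psi_algebraMap]

/-- `L = F(W₂)(x₁, y₁)`. [folklore] -/
theorem adjoin_xL_yL_eq_top : letI := (φ.psiField L).toAlgebra;
    IntermediateField.adjoin W₂.toAffine.FunctionField {xL W₁ L, yL W₁ L} = ⊤ := by
  letI := (φ.psiField L).toAlgebra
  haveI := φ.isScalarTower_psiField' L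
  set E := IntermediateField.adjoin W₂.toAffine.FunctionField {xL W₁ L, yL W₁ L}
  have hx : xL W₁ L ∈ E := IntermediateField.subset_adjoin _ _ (Set.mem_insert _ _)
  have hy : yL W₁ L ∈ E :=
    IntermediateField.subset_adjoin _ _ (Set.mem_insert_of_mem _ (Set.mem_singleton _))
  have hc : ∀ c : F, algebraMap F L c ∈ E := fun c => by
    rw [IsScalarTower.algebraMap_apply F W₂.toAffine.FunctionField L]
    exact IntermediateField.algebraMap_mem E _
  have hp : ∀ p : F[X], toL W₁ L p ∈ E := by
    intro p
    induction p using Polynomial.induction_on' with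
    | add p q hp hq => rw [map_add]; exact add_mem hp hq
    | monomial n c =>
      rw [← C_mul_X_pow_eq_monomial, map_mul, map_pow, toL_C, toL_X]
      exact mul_mem (hc c) (pow_mem hx n)
  have hr : ∀ r : W₁.toAffine.CoordinateRing, algebraMap _ L r ∈ E := by
    intro r
    obtain ⟨a, b, rfl⟩ := Literature.NumberTheory.EllipticCurves.WeierstrassCoordinateRing.exists_eq_add_mul_y r
    rw [map_add, map_mul]
    exact add_mem (hp a) (mul_mem (hp b) hy)
  rw [eq_top_iff]
  intro z _
  obtain ⟨a, b, -, rfl⟩ := IsFractionRing.div_surjective (A := W₁.toAffine.CoordinateRing) z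
  exact div_mem (hr a) (hr b)

/-- **`[L : F(W₂)] < ∞`**: `L` is generated over `F(W₂)` by the two algebraic elements `x₁, y₁`.
[folklore] -/
theorem finiteDimensional_psiField : letI := (φ.psiField L).toAlgebra;
    FiniteDimensional W₂.toAffine.FunctionField L := by
  letI := (φ.psi L).toAlgebra
  letI := (φ.psiField L).toAlgebra
  haveI := φ.isScalarTower_psiField L
  have hint : ∀ z ∈ ({xL W₁ L, yL W₁ L} : Set L), _root_.IsIntegral W₂.toAffine.FunctionField z := by
    rintro z (rfl | hz)
    · exact (φ.isIntegral_xL L).tower_top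
    · rw [Set.mem_singleton_iff] at hz
      rw [hz]
      exact (φ.isIntegral_yL L).tower_top
  haveI := IntermediateField.finiteDimensional_adjoin hint
  rw [φ.adjoin_xL_yL_eq_top L] at this
  exact IntermediateField.topEquiv.toLinearEquiv.finiteDimensional

end FunctionField

/-! ### Regularity of `ψ` at the points with `h ≠ 0`, and additivity of the point map -/

section Regular

variable {F : Type u} [Field F] {W₁ W₂ : WeierstrassCurve F}

/-- `p(x₁) ∈ 𝔪_{(a,b)}` when `p(a) = 0`. [folklore] -/
theorem algebraMap_polynomial_mem_XYIdeal {a : F} (b : F) {p : F[X]} (hp : p.eval a = 0) :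
    algebraMap F[X] W₁.toAffine.CoordinateRing p ∈
      WeierstrassCurve.Affine.CoordinateRing.XYIdeal W₁.toAffine a (C b) := by
  have hdec : p = (X - C a) * (p /ₘ (X - C a)) := by
    conv_lhs => rw [← modByMonic_add_div p (X - C a), modByMonic_X_sub_C_eq_C_eval, hp,
      C_0, zero_add]
  rw [hdec, map_mul, map_sub, show algebraMap F[X] W₁.toAffine.CoordinateRing (C a) =
    algebraMap F W₁.toAffine.CoordinateRing a from rfl]
  exact Ideal.mul_mem_right _ _ (Literature.NumberTheory.EllipticCurves.RationalMapHom.mk_X_sub_mem_XYIdeal W₁.toAffine a (C b))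

/-- `p(x₁) ∉ 𝔪_{(a,b)}` when `p(a) ≠ 0` (and `(a, b)` is on the curve). [folklore] -/
theorem algebraMap_polynomial_not_mem_XYIdeal {a b : F} (hab : W₁.toAffine.Equation a b) {p : F[X]}
    (hp : p.eval a ≠ 0) :
    algebraMap F[X] W₁.toAffine.CoordinateRing p ∉
      WeierstrassCurve.Affine.CoordinateRing.XYIdeal W₁.toAffine a (C b) := by
  intro hmem
  have hdec : p = (X - C a) * (p /ₘ (X - C a)) + C (p.eval a) := by
    conv_lhs => rw [← modByMonic_add_div p (X - C a), modByMonic_X_sub_C_eq_C_eval, add_comm]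
  have hC : C (p.eval a) = p - (X - C a) * (p /ₘ (X - C a)) := by
    rw [eq_sub_iff_add_eq, add_comm]; exact hdec.symm
  have h1 : algebraMap F[X] W₁.toAffine.CoordinateRing ((X - C a) * (p /ₘ (X - C a))) ∈
      WeierstrassCurve.Affine.CoordinateRing.XYIdeal W₁.toAffine a (C b) :=
    algebraMap_polynomial_mem_XYIdeal b (by simp)
  have h2 : algebraMap F W₁.toAffine.CoordinateRing (p.eval a) ∈
      WeierstrassCurve.Affine.CoordinateRing.XYIdeal W₁.toAffine a (C b) := by
    rw [show algebraMap F W₁.toAffine.CoordinateRing (p.eval a) =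
      algebraMap F[X] W₁.toAffine.CoordinateRing (C (p.eval a)) from rfl, hC, map_sub]
    exact Ideal.sub_mem _ hmem h1
  exact (Literature.NumberTheory.EllipticCurves.RationalMapHom.isMaximal_XYIdeal W₁.toAffine hab).ne_top
    (Ideal.eq_top_of_isUnit_mem _ h2 ((IsUnit.mk0 _ hp).map _))

variable (L : Type v) [Field L] [Algebra W₁.toAffine.CoordinateRing L] [Algebra F L]
  [IsScalarTower F W₁.toAffine.CoordinateRing L]

/-- Polynomial expressions in an element of a subalgebra containing the constants stay in it.
[folklore] -/
theorem eval₂_mem_subalgebra {S : Subalgebra W₁.toAffine.CoordinateRing L} {z : L} (hz : z ∈ S)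
    (p : F[X]) : p.eval₂ (algebraMap F L) z ∈ S := by
  induction p using Polynomial.induction_on' with
  | add p q hp hq => rw [eval₂_add]; exact add_mem hp hq
  | monomial n c =>
    rw [eval₂_monomial, IsScalarTower.algebraMap_apply F W₁.toAffine.CoordinateRing L]
    exact mul_mem (Subalgebra.algebraMap_mem _ _) (pow_mem hz n)

variable [IsFractionRing W₁.toAffine.CoordinateRing L] (φ : IsogenyFormula W₁ W₂)

/-- **Regularity**: at a point `(a, b)` of `W₁` with `h(a) ≠ 0`, `ψ` takes values in the local ring
`𝒪_{W₁,(a,b)}` (the denominators `h(x₁)^k` are units there). [folklore] -/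
theorem psi_mem_localRingAt {a b : F} (hab : W₁.toAffine.Equation a b) (ha : φ.h.eval a ≠ 0)
    (r : W₂.toAffine.CoordinateRing) :
    φ.psi L r ∈ Literature.NumberTheory.EllipticCurves.RationalMapHom.localRingAt W₁.toAffine L hab := by
  set D := Literature.NumberTheory.EllipticCurves.RationalMapHom.localRingAt W₁.toAffine L hab
  have hhk : ∀ k : ℕ, algebraMap F[X] W₁.toAffine.CoordinateRing (φ.h ^ k) ∉
      WeierstrassCurve.Affine.CoordinateRing.XYIdeal W₁.toAffine a (C b) := fun k =>
    algebraMap_polynomial_not_mem_XYIdeal hab (by rw [eval_pow]; exact pow_ne_zero k ha)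
  have hx : φ.x' L ∈ D := by
    have := Literature.NumberTheory.EllipticCurves.RationalMapHom.div_mem_localRingAt (L := L) hab
      (algebraMap F[X] W₁.toAffine.CoordinateRing φ.U) (hhk 2)
    rwa [map_pow, map_pow] at this
  have hy : φ.y' L ∈ D := by
    have := Literature.NumberTheory.EllipticCurves.RationalMapHom.div_mem_localRingAt (L := L) hab
      (algebraMap F[X] W₁.toAffine.CoordinateRing φ.S *
          WeierstrassCurve.Affine.CoordinateRing.mk W₁.toAffine Y +
        algebraMap F[X] W₁.toAffine.CoordinateRing φ.T) (hhk 3)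
    rwa [map_pow, map_pow, map_add, map_mul] at this
  obtain ⟨p, q, rfl⟩ := Literature.NumberTheory.EllipticCurves.WeierstrassCoordinateRing.exists_eq_add_mul_y r
  rw [map_add, map_mul, psi_algebraMap_polynomial, psi_algebraMap_polynomial, psi_mk_Y]
  exact add_mem (eval₂_mem_subalgebra L hx p) (mul_mem (eval₂_mem_subalgebra L hx q) hy)

/-- The `x`-witness: `x' - U(a)/h(a)² = N(x₁) · (h(x₁)² h(a)²)⁻¹` with
`N = U · h(a)² - U(a) · h² ∈ F[X]` vanishing at `a`. [folklore] -/
theorem x'_sub_valX {a b : F} (hab : W₁.toAffine.Equation a b) (ha : φ.h.eval a ≠ 0) :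
    ∃ m ∈ WeierstrassCurve.Affine.CoordinateRing.XYIdeal W₁.toAffine a (C b),
      ∃ d ∈ Literature.NumberTheory.EllipticCurves.RationalMapHom.localRingAt W₁.toAffine L hab,
        φ.x' L - algebraMap F L (φ.valX a) = algebraMap W₁.toAffine.CoordinateRing L m * d := by
  set N : F[X] := φ.U * C (φ.h.eval a ^ 2) - C (φ.U.eval a) * φ.h ^ 2 with hN
  refine ⟨algebraMap F[X] _ N, algebraMap_polynomial_mem_XYIdeal b (by simp [hN]),
    algebraMap _ L 1 / algebraMap _ L (algebraMap F[X] _ (φ.h ^ 2 * C (φ.h.eval a ^ 2))),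
    Literature.NumberTheory.EllipticCurves.RationalMapHom.div_mem_localRingAt hab 1 (algebraMap_polynomial_not_mem_XYIdeal hab
      (by simp [ha])), ?_⟩
  have hh : toL W₁ L φ.h ≠ 0 := toL_h_ne_zero L φ
  have hha : algebraMap F L (φ.h.eval a) ≠ 0 := (_root_.map_ne_zero _).mpr ha
  change _ = toL W₁ L N * (algebraMap _ L 1 / toL W₁ L _)
  simp only [hN, valX, map_sub, map_mul, map_pow, map_one, toL_C, map_div₀, x']
  field_simp

/-- The `y`-witness: `y' - (S(a)b + T(a))/h(a)³ = M · (h(x₁)³ h(a)³)⁻¹` with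
`M = (S(x₁) y₁ + T(x₁)) h(a)³ - (S(a) b + T(a)) h(x₁)³ ∈ 𝔪_{(a,b)}`. [folklore] -/
theorem y'_sub_valY {a b : F} (hab : W₁.toAffine.Equation a b) (ha : φ.h.eval a ≠ 0) :
    ∃ m ∈ WeierstrassCurve.Affine.CoordinateRing.XYIdeal W₁.toAffine a (C b),
      ∃ d ∈ Literature.NumberTheory.EllipticCurves.RationalMapHom.localRingAt W₁.toAffine L hab,
        φ.y' L - algebraMap F L (φ.valY a b) = algebraMap W₁.toAffine.CoordinateRing L m * d := by
  set G : F[X] := φ.S * C (φ.h.eval a ^ 3 * b) + φ.T * C (φ.h.eval a ^ 3) -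
    C (φ.S.eval a * b + φ.T.eval a) * φ.h ^ 3 with hG
  set M : W₁.toAffine.CoordinateRing :=
    algebraMap F[X] _ (φ.S * C (φ.h.eval a ^ 3)) *
      (WeierstrassCurve.Affine.CoordinateRing.mk W₁.toAffine Y - algebraMap F _ b) +
    algebraMap F[X] _ G with hM
  have hMmem : M ∈ WeierstrassCurve.Affine.CoordinateRing.XYIdeal W₁.toAffine a (C b) :=
    Ideal.add_mem _ (Ideal.mul_mem_left _ _ (Literature.NumberTheory.EllipticCurves.RationalMapHom.mk_Y_sub_mem_XYIdeal _ a b))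
      (algebraMap_polynomial_mem_XYIdeal b (by simp [hG]; ring))
  refine ⟨M, hMmem,
    algebraMap _ L 1 / algebraMap _ L (algebraMap F[X] _ (φ.h ^ 3 * C (φ.h.eval a ^ 3))),
    Literature.NumberTheory.EllipticCurves.RationalMapHom.div_mem_localRingAt hab 1 (algebraMap_polynomial_not_mem_XYIdeal hab
      (by simp [ha])), ?_⟩
  have hh : toL W₁ L φ.h ≠ 0 := toL_h_ne_zero L φ
  have hha : algebraMap F L (φ.h.eval a) ≠ 0 := (_root_.map_ne_zero _).mpr ha
  have hMv : algebraMap W₁.toAffine.CoordinateRing L M =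
      toL W₁ L (φ.S * C (φ.h.eval a ^ 3)) * (yL W₁ L - algebraMap F L b) + toL W₁ L G := by
    rw [hM, map_add, map_mul, map_sub, ← IsScalarTower.algebraMap_apply F W₁.toAffine.CoordinateRing L]
    rfl
  rw [hMv]
  change _ = _ * (algebraMap _ L 1 / toL W₁ L _)
  simp only [hG, valY, map_sub, map_mul, map_pow, map_one, map_add, toL_C, map_div₀, y']
  field_simp
  ring

end Regular

section Additive

variable {F : Type u} [Field F] [DecidableEq F] [CharZero F] {W₁ W₂ : WeierstrassCurve F}
  [W₁.IsElliptic] [W₂.IsElliptic] (φ : IsogenyFormula W₁ W₂)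

/-- **Additivity of the point map off `h = 0`** (Silverman, *AEC*, Thm. III.4.8 for the rational
map `(U/h², (S y + T)/h³)`): if `P, Q, P + Q` are affine points of `W₁` at which `h ≠ 0` then
`f(P + Q) = f(P) + f(Q)`. Proof: `Literature.NumberTheory.EllipticCurves.RationalMapHom.some_add_some_eq` in `L = F(W₁)` with
`ψ : F[W₂] → F(W₁)`. [cite: SilvermanAEC2009, Thm. III.4.8 (PDF pp. 70–71)] -/
theorem pointFun_add_of_eval_ne_zero {a₁ b₁ a₂ b₂ a₃ b₃ : F}
    (h₁ : W₁.toAffine.Nonsingular a₁ b₁) (h₂ : W₁.toAffine.Nonsingular a₂ b₂)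
    (h₃ : W₁.toAffine.Nonsingular a₃ b₃)
    (hsum : WeierstrassCurve.Affine.Point.some _ _ h₁ + WeierstrassCurve.Affine.Point.some _ _ h₂ =
      WeierstrassCurve.Affine.Point.some _ _ h₃)
    (ha₁ : φ.h.eval a₁ ≠ 0) (ha₂ : φ.h.eval a₂ ≠ 0) (ha₃ : φ.h.eval a₃ ≠ 0) :
    φ.pointFun (WeierstrassCurve.Affine.Point.some _ _ h₁) +
        φ.pointFun (WeierstrassCurve.Affine.Point.some _ _ h₂) =
      φ.pointFun (WeierstrassCurve.Affine.Point.some _ _ h₃) := by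
  rw [φ.pointFun_some h₁ ha₁, φ.pointFun_some h₂ ha₂, φ.pointFun_some h₃ ha₃]
  let L := W₁.toAffine.FunctionField
  letI := (φ.psi L).toAlgebra
  haveI := φ.isScalarTower_psi L
  haveI := φ.faithfulSMul_psi L
  letI := (φ.psiField L).toAlgebra
  haveI := φ.isScalarTower_psiField L
  haveI := φ.finiteDimensional_psiField L
  haveI : Module.Finite W₂.toAffine.CoordinateRing
      (integralClosure W₂.toAffine.CoordinateRing L) :=
    IsIntegralClosure.finite W₂.toAffine.CoordinateRing W₂.toAffine.FunctionField L _
  have hx' : algebraMap W₂.toAffine.CoordinateRing L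
      (WeierstrassCurve.Affine.CoordinateRing.mk W₂.toAffine (C X)) = φ.x' L := φ.psi_mk_C_X L
  have hy' : algebraMap W₂.toAffine.CoordinateRing L
      (WeierstrassCurve.Affine.CoordinateRing.mk W₂.toAffine Y) = φ.y' L := φ.psi_mk_Y L
  have wx₁ := φ.x'_sub_valX L h₁.1 ha₁
  have wy₁ := φ.y'_sub_valY L h₁.1 ha₁
  have wx₂ := φ.x'_sub_valX L h₂.1 ha₂
  have wy₂ := φ.y'_sub_valY L h₂.1 ha₂
  have wx₃ := φ.x'_sub_valX L h₃.1 ha₃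
  have wy₃ := φ.y'_sub_valY L h₃.1 ha₃
  rw [← hx'] at wx₁ wx₂ wx₃
  rw [← hy'] at wy₁ wy₂ wy₃
  exact Literature.NumberTheory.EllipticCurves.RationalMapHom.some_add_some_eq (φ.gensIntegral L) h₁ h₂ h₃ hsum
    (φ.psi_mem_localRingAt L h₁.1 ha₁) (φ.psi_mem_localRingAt L h₂.1 ha₂)
    (φ.psi_mem_localRingAt L h₃.1 ha₃) _ _ _ wx₁ wy₁ wx₂ wy₂ wx₃ wy₃

end Additive

end IsogenyFormula

end WeierstrassCurve

/-! ## Extending a map that is additive off a finite set -/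

namespace Literature.NumberTheory.EllipticCurves.RationalMapHom

section Extend

/-- In an infinite type one can avoid finitely many preimages of a finite set under injective maps
`c₁, …, cₙ : G → G`: there is `Q` with `cᵢ(Q) ∉ B` for all `i`. [folklore] -/
theorem exists_forall_apply_not_mem {G : Type*} [Infinite G] {B : Set G} (hB : B.Finite)
    (cs : List (G → G)) (hcs : ∀ c ∈ cs, Function.Injective c) :
    ∃ Q : G, ∀ c ∈ cs, c Q ∉ B := by
  have hfin : {Q : G | ∃ c ∈ cs, c Q ∈ B}.Finite := by
    have : {Q : G | ∃ c ∈ cs, c Q ∈ B} = ⋃ c ∈ {c : G → G | c ∈ cs}, c ⁻¹' B := by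
      ext Q; simp
    rw [this]
    exact Set.Finite.biUnion (List.finite_toSet cs) fun c hc => hB.preimage (hcs c hc).injOn
  obtain ⟨Q, -, hQ⟩ := (Set.infinite_univ.sdiff hfin).nonempty
  exact ⟨Q, fun c hc hcQ => hQ ⟨c, hc, hcQ⟩⟩

variable {G H : Type*} [AddCommGroup G] [AddCommGroup H] [Infinite G]

/-- A choice of auxiliary point: `Q ∉ B` with `P - Q ∉ B`. [folklore] -/
theorem exists_aux {B : Set G} (hB : B.Finite) (P : G) : ∃ Q : G, Q ∉ B ∧ P - Q ∉ B := by
  obtain ⟨Q, hQ⟩ := exists_forall_apply_not_mem hB [id, (P - ·)] (by simp [Function.Injective])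
  exact ⟨Q, hQ id (by simp), hQ (P - ·) (by simp)⟩

variable {B : Set G} (hB : B.Finite) (f : G → H)
  (hf : ∀ P Q, P ∉ B → Q ∉ B → P + Q ∉ B → f (P + Q) = f P + f Q)
include hB hf

/-- Well-definedness: `f Q + f (P - Q)` does not depend on the auxiliary point `Q ∉ B` with
`P - Q ∉ B`. [folklore] -/
theorem add_apply_sub_eq (P : G) {Q₁ Q₂ : G} (hQ₁ : Q₁ ∉ B) (hPQ₁ : P - Q₁ ∉ B) (hQ₂ : Q₂ ∉ B)
    (hPQ₂ : P - Q₂ ∉ B) : f Q₁ + f (P - Q₁) = f Q₂ + f (P - Q₂) := by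
  -- auxiliary generic points `R, R'`
  obtain ⟨R, hR⟩ := exists_forall_apply_not_mem hB [id, (Q₁ + ·), (Q₂ + ·)]
    (by simp [Function.Injective])
  have hR0 : R ∉ B := hR id (by simp)
  have hR1 : Q₁ + R ∉ B := hR (Q₁ + ·) (by simp)
  have hR2 : Q₂ + R ∉ B := hR (Q₂ + ·) (by simp)
  obtain ⟨R', hR'⟩ := exists_forall_apply_not_mem hB
    [id, (P - Q₁ + ·), (P - Q₂ + ·), (P + R + ·)] (by simp [Function.Injective])
  have hR'0 : R' ∉ B := hR' id (by simp)
  have hR'1 : P - Q₁ + R' ∉ B := hR' (P - Q₁ + ·) (by simp)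
  have hR'2 : P - Q₂ + R' ∉ B := hR' (P - Q₂ + ·) (by simp)
  have hR'3 : P + R + R' ∉ B := hR' (P + R + ·) (by simp)
  have key : ∀ Q, Q ∉ B → P - Q ∉ B → Q + R ∉ B → P - Q + R' ∉ B →
      f Q + f (P - Q) + (f R + f R') = f (P + R + R') := by
    intro Q hQ hPQ hQR hPQR'
    have e3 : Q + R + (P - Q + R') = P + R + R' := by abel
    rw [show f Q + f (P - Q) + (f R + f R') = (f Q + f R) + (f (P - Q) + f R') by abel,
      ← hf Q R hQ hR0 hQR, ← hf (P - Q) R' hPQ hR'0 hPQR', ← hf _ _ hQR hPQR' (e3 ▸ hR'3), e3]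
  have h1 := key Q₁ hQ₁ hPQ₁ hR1 hR'1
  have h2 := key Q₂ hQ₂ hPQ₂ hR2 hR'2
  exact add_right_cancel (h1.trans h2.symm)

/-- **The extension**: the function `P ↦ f Q + f (P - Q)` (`Q, P - Q ∉ B`). [folklore] -/
noncomputable def extendFun (P : G) : H :=
  f (exists_aux hB P).choose + f (P - (exists_aux hB P).choose)

/-- The extension computed with any admissible auxiliary point. [folklore] -/
theorem extendFun_eq (P : G) {Q : G} (hQ : Q ∉ B) (hPQ : P - Q ∉ B) :
    extendFun hB f P = f Q + f (P - Q) :=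
  add_apply_sub_eq hB f hf P (exists_aux hB P).choose_spec.1 (exists_aux hB P).choose_spec.2 hQ hPQ

/-- The extension agrees with `f` off `B`. [folklore] -/
theorem extendFun_eq_self {P : G} (hP : P ∉ B) : extendFun hB f P = f P := by
  obtain ⟨Q, hQ⟩ := exists_forall_apply_not_mem hB [id, (P - ·)]
    (by simp [Function.Injective])
  have hQ0 : Q ∉ B := hQ id (by simp)
  have hPQ : P - Q ∉ B := hQ (P - ·) (by simp)
  rw [extendFun_eq hB f hf P hQ0 hPQ, ← hf Q (P - Q) hQ0 hPQ (by rwa [add_sub_cancel]),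
    add_sub_cancel]

/-- The extension is additive. [folklore] -/
theorem extendFun_add (P₁ P₂ : G) :
    extendFun hB f (P₁ + P₂) = extendFun hB f P₁ + extendFun hB f P₂ := by
  obtain ⟨Q₁, hQ₁⟩ := exists_forall_apply_not_mem hB [id, (P₁ - ·)]
    (by simp [Function.Injective])
  have hQ₁0 : Q₁ ∉ B := hQ₁ id (by simp)
  have hPQ₁ : P₁ - Q₁ ∉ B := hQ₁ (P₁ - ·) (by simp)
  obtain ⟨Q₂, hQ₂⟩ := exists_forall_apply_not_mem hB
    [id, (P₂ - ·), (Q₁ + ·), (P₁ - Q₁ + P₂ - ·)]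
    (by simp [Function.Injective])
  have hQ₂0 : Q₂ ∉ B := hQ₂ id (by simp)
  have hPQ₂ : P₂ - Q₂ ∉ B := hQ₂ (P₂ - ·) (by simp)
  have hQ₁₂ : Q₁ + Q₂ ∉ B := hQ₂ (Q₁ + ·) (by simp)
  have hPQ₁₂ : P₁ - Q₁ + P₂ - Q₂ ∉ B := hQ₂ (P₁ - Q₁ + P₂ - ·) (by simp)
  have e1 : P₁ + P₂ - (Q₁ + Q₂) = P₁ - Q₁ + (P₂ - Q₂) := by abel
  have e2 : P₁ - Q₁ + P₂ - Q₂ = P₁ - Q₁ + (P₂ - Q₂) := by abel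
  rw [e2] at hPQ₁₂
  rw [extendFun_eq hB f hf P₁ hQ₁0 hPQ₁, extendFun_eq hB f hf P₂ hQ₂0 hPQ₂,
    extendFun_eq hB f hf (P₁ + P₂) hQ₁₂ (by rwa [e1]), e1, hf _ _ hQ₁0 hQ₂0 hQ₁₂,
    hf _ _ hPQ₁ hPQ₂ hPQ₁₂]
  abel

/-- **Extension of a map additive off a finite subset of an infinite abelian group** to a group
homomorphism agreeing with it off that subset. [folklore] -/
noncomputable def extend : G →+ H :=
  AddMonoidHom.mk' (extendFun hB f) (extendFun_add hB f hf)

/-- The extension agrees with `f` off `B`. [folklore] -/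
theorem extend_apply_of_not_mem {P : G} (hP : P ∉ B) : extend hB f hf P = f P :=
  extendFun_eq_self hB f hf hP

end Extend

end Literature.NumberTheory.EllipticCurves.RationalMapHom

/-! ## The isogeny attached to an isogeny formula (geometric points) -/

namespace WeierstrassCurve

namespace IsogenyFormula

section Bad

variable {F : Type u} [Field F] {W₁ W₂ : WeierstrassCurve F} (φ : IsogenyFormula W₁ W₂)

/-- The exceptional set of the provisional point map: `O` and the affine points with `h(x) = 0`.
[folklore] -/
def bad : Set W₁.toAffine.Point :=
  {P | ∀ x y (hxy : W₁.toAffine.Nonsingular x y), P = .some _ _ hxy → φ.h.eval x = 0}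

/-- `O` is exceptional. [folklore] -/
theorem zero_mem_bad : (0 : W₁.toAffine.Point) ∈ φ.bad := fun _ _ _ h => by cases h

/-- An affine point is exceptional iff `h(x) = 0`. [folklore] -/
theorem some_mem_bad_iff {x y : F} (hxy : W₁.toAffine.Nonsingular x y) :
    WeierstrassCurve.Affine.Point.some _ _ hxy ∈ φ.bad ↔ φ.h.eval x = 0 := by
  refine ⟨fun h => h x y hxy rfl, fun h x' y' hxy' e => ?_⟩
  cases e
  exact h

/-- A point off the exceptional set is affine with `h(x) ≠ 0`. [folklore] -/
theorem exists_of_not_mem_bad {P : W₁.toAffine.Point} (hP : P ∉ φ.bad) :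
    ∃ x y, ∃ hxy : W₁.toAffine.Nonsingular x y, P = .some _ _ hxy ∧ φ.h.eval x ≠ 0 := by
  rcases P with _ | ⟨x, y, hxy⟩
  · exact absurd φ.zero_mem_bad hP
  · exact ⟨x, y, hxy, rfl, fun h => hP ((φ.some_mem_bad_iff hxy).mpr h)⟩

/-- The exceptional set is finite (`h ≠ 0` has finitely many roots, each the `x`-coordinate of at
most two points). [folklore] -/
theorem finite_bad : φ.bad.Finite := by
  classical
  let q : F → F[X] := fun x => C (1 : F) * X ^ 2 + C (W₁.a₁ * x + W₁.a₃) * X +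
    C (-(x ^ 3 + W₁.a₂ * x ^ 2 + W₁.a₄ * x + W₁.a₆))
  have hq : ∀ x, q x ≠ 0 := fun x h0 => by
    have := degree_quadratic (b := W₁.a₁ * x + W₁.a₃)
      (c := -(x ^ 3 + W₁.a₂ * x ^ 2 + W₁.a₄ * x + W₁.a₆)) (one_ne_zero (α := F))
    rw [show C (1 : F) * X ^ 2 + C (W₁.a₁ * x + W₁.a₃) * X +
      C (-(x ^ 3 + W₁.a₂ * x ^ 2 + W₁.a₄ * x + W₁.a₆)) = q x from rfl, h0, degree_zero] at this
    exact absurd this (by decide)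
  let pt : F → F → W₁.toAffine.Point := fun x y =>
    if h : W₁.toAffine.Nonsingular x y then .some _ _ h else 0
  refine (((φ.h.roots.toFinset : Set F).toFinite.biUnion fun x _ =>
    ((q x).roots.toFinset : Set F).toFinite.image (pt x)).insert 0).subset ?_
  rintro (_ | ⟨x, y, hxy⟩) hP
  · exact Set.mem_insert _ _
  · refine Set.mem_insert_of_mem _ (Set.mem_biUnion (x := x) ?_ ?_)
    · rw [Finset.mem_coe, Multiset.mem_toFinset, mem_roots φ.h_ne_zero]
      exact (φ.some_mem_bad_iff hxy).mp hP
    · refine ⟨y, ?_, by simp [pt, hxy]⟩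
      rw [Finset.mem_coe, Multiset.mem_toFinset, mem_roots (hq x)]
      have he := (WeierstrassCurve.Affine.equation_iff x y).mp hxy.1
      simp only [q, IsRoot.def, eval_add, eval_mul, eval_C, eval_pow, eval_X, one_mul]
      linear_combination he

variable [DecidableEq F] [CharZero F] [W₁.IsElliptic] [W₂.IsElliptic]

/-- **Additivity off the exceptional set.** [cite: SilvermanAEC2009, Thm. III.4.8 (PDF pp. 70–71)] -/
theorem pointFun_add (P Q : W₁.toAffine.Point) (hP : P ∉ φ.bad)
    (hQ : Q ∉ φ.bad) (hPQ : P + Q ∉ φ.bad) :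
    φ.pointFun (P + Q) = φ.pointFun P + φ.pointFun Q := by
  obtain ⟨x₁, y₁, h₁, rfl, hx₁⟩ := φ.exists_of_not_mem_bad hP
  obtain ⟨x₂, y₂, h₂, rfl, hx₂⟩ := φ.exists_of_not_mem_bad hQ
  obtain ⟨x₃, y₃, h₃, h₃eq, hx₃⟩ := φ.exists_of_not_mem_bad hPQ
  rw [h₃eq]
  exact (φ.pointFun_add_of_eval_ne_zero h₁ h₂ h₃ h₃eq hx₁ hx₂ hx₃).symm

end Bad

section Geom

open scoped Classical

/-- Evaluating a one-variable polynomial placed in the first of two variables. [folklore] -/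
theorem eval_aeval_X_zero {A : Type*} [CommRing A] (p : A[X]) (v : Fin 2 → A) :
    MvPolynomial.eval v (Polynomial.aeval (MvPolynomial.X 0 : MvPolynomial (Fin 2) A) p) =
      p.eval (v 0) := by
  rw [Polynomial.aeval_def, MvPolynomial.algebraMap_eq, Polynomial.hom_eval₂, MvPolynomial.eval_X]
  have : (MvPolynomial.eval v).comp (MvPolynomial.C) = RingHom.id A :=
    RingHom.ext fun a => MvPolynomial.eval_C a
  rw [this]
  rfl

variable {K : Type u} [Field K]

/-- `σ(p̄(x)) = p̄(σ x)` for `p ∈ K[X]` read in `K̄`. [folklore] -/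
theorem map_eval_map (σ : AlgebraicClosure K →ₐ[K] AlgebraicClosure K) (p : K[X])
    (x : AlgebraicClosure K) :
    σ ((p.map (algebraMap K (AlgebraicClosure K))).eval x) =
      (p.map (algebraMap K (AlgebraicClosure K))).eval (σ x) := by
  rw [Polynomial.eval_map, Polynomial.eval_map, ← Polynomial.aeval_def, ← Polynomial.aeval_def,
    Polynomial.aeval_algHom_apply]

variable {W₁ W₂ : WeierstrassCurve K} (φ : IsogenyFormula W₁ W₂)

/-- The formula read over `K̄`. [folklore] -/
def geom : IsogenyFormula (W₁.baseChange (AlgebraicClosure K)) (W₂.baseChange (AlgebraicClosure K)) :=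
  φ.map (algebraMap K (AlgebraicClosure K)) (algebraMap K (AlgebraicClosure K)).injective

/-- The exceptional set is `Γ_K`-stable. [folklore] -/
theorem smul_mem_bad_iff (σ : Field.absoluteGaloisGroup K) (P : W₁.geomPoints) :
    σ • P ∈ (φ.geom.bad : Set W₁.geomPoints) ↔ P ∈ (φ.geom.bad : Set W₁.geomPoints) := by
  set τ : AlgebraicClosure K →ₐ[K] AlgebraicClosure K :=
    ((show AlgebraicClosure K ≃ₐ[K] AlgebraicClosure K from σ) :
      AlgebraicClosure K →ₐ[K] AlgebraicClosure K) with hτ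
  rcases P with _ | ⟨x, y, hxy⟩
  · change σ • (0 : W₁.geomPoints) ∈ (φ.geom.bad : Set W₁.geomPoints) ↔ _
    rw [smul_zero]
    rfl
  · change Affine.Point.map τ (Affine.Point.some x y hxy) ∈ φ.geom.bad ↔
      Affine.Point.some x y hxy ∈ φ.geom.bad
    rw [Affine.Point.map_some, φ.geom.some_mem_bad_iff, φ.geom.some_mem_bad_iff,
      show φ.geom.h.eval (τ x) = τ (φ.geom.h.eval x) from (map_eval_map τ φ.h x).symm,
      map_eq_zero_iff τ τ.injective]

variable [W₂.IsElliptic]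

/-- The provisional map on geometric points. [folklore] -/
def geomFun : W₁.geomPoints → W₂.geomPoints :=
  φ.geom.pointFun

/-! #### Galois equivariance -/

/-- The provisional map is `Γ_K`-equivariant (its formula has coefficients in `K`, and its
exceptional set is `Γ_K`-stable). [folklore] -/
theorem geomFun_smul (σ : Field.absoluteGaloisGroup K) (P : W₁.geomPoints) :
    φ.geomFun (σ • P) = σ • φ.geomFun P := by
  set τ : AlgebraicClosure K →ₐ[K] AlgebraicClosure K :=
    ((show AlgebraicClosure K ≃ₐ[K] AlgebraicClosure K from σ) :
      AlgebraicClosure K →ₐ[K] AlgebraicClosure K) with hτ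
  rcases P with _ | ⟨x, y, hxy⟩
  · change φ.geomFun (σ • (0 : W₁.geomPoints)) = σ • (0 : W₂.geomPoints)
    rw [smul_zero, smul_zero]
    rfl
  · show φ.geom.pointFun (Affine.Point.map τ (Affine.Point.some x y hxy)) =
      Affine.Point.map τ (φ.geom.pointFun (Affine.Point.some x y hxy))
    rw [Affine.Point.map_some]
    have hh : φ.geom.h.eval (τ x) = τ (φ.geom.h.eval x) := (map_eval_map τ φ.h x).symm
    by_cases hx : φ.geom.h.eval x = 0
    · have hσx : φ.geom.h.eval (τ x) = 0 := by rw [hh, hx, map_zero]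
      rw [φ.geom.pointFun_some_of_eval_eq_zero _ hσx, φ.geom.pointFun_some_of_eval_eq_zero _ hx,
        Affine.Point.map_zero]
    · have hσx : φ.geom.h.eval (τ x) ≠ 0 := by rw [hh]; exact (map_ne_zero τ).mpr hx
      rw [φ.geom.pointFun_some _ hσx, φ.geom.pointFun_some _ hx, Affine.Point.map_some]
      congr 1
      · simp only [valX, geom, map_U, map_h, map_div₀, map_pow, map_eval_map]
      · simp only [valY, geom, map_S, map_T, map_h, map_div₀, map_pow, map_add, map_mul,
          map_eval_map]

variable [W₁.IsElliptic]

variable [CharZero K]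


/-- **The isogeny on geometric points**: the unique homomorphism `E₁(K̄) → E₂(K̄)` agreeing with the
formula off the (finite) exceptional set. [folklore] -/
def geomHom : W₁.geomPoints →+ W₂.geomPoints :=
  Literature.NumberTheory.EllipticCurves.RationalMapHom.extend φ.geom.finite_bad φ.geomFun φ.geom.pointFun_add

/-- Off the exceptional set the homomorphism is the formula. [folklore] -/
theorem geomHom_apply_of_not_mem {P : W₁.geomPoints} (hP : P ∉ φ.geom.bad) :
    φ.geomHom P = φ.geom.pointFun P :=
  Literature.NumberTheory.EllipticCurves.RationalMapHom.extend_apply_of_not_mem _ _ _ hP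

/-- The value at a good affine point. [folklore] -/
theorem geomHom_some {x y : AlgebraicClosure K}
    (hxy : (W₁.baseChange (AlgebraicClosure K)).toAffine.Nonsingular x y)
    (hx : φ.geom.h.eval x ≠ 0) :
    φ.geomHom (WeierstrassCurve.Affine.Point.some _ _ hxy) =
      WeierstrassCurve.Affine.Point.some _ _ (φ.geom.nonsingular_val hxy.1 hx) := by
  rw [φ.geomHom_apply_of_not_mem (fun h => hx ((φ.geom.some_mem_bad_iff hxy).mp h))]
  exact φ.geom.pointFun_some hxy hx

/-! #### Algebraicity -/

/-- The homomorphism is given by the rational map `(U/h², (S y + T)/h³)` off the exceptional set.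
[folklore] -/
theorem isAlgebraicOn_geomHom : IsAlgebraicOn W₁ W₂ φ.geomHom := by
  refine ⟨Polynomial.aeval (MvPolynomial.X 0) φ.geom.U, Polynomial.aeval (MvPolynomial.X 0) (φ.geom.h ^ 2),
    Polynomial.aeval (MvPolynomial.X 0) φ.geom.S * MvPolynomial.X 1 +
      Polynomial.aeval (MvPolynomial.X 0) φ.geom.T,
    Polynomial.aeval (MvPolynomial.X 0) (φ.geom.h ^ 3), φ.geom.finite_bad.subset ?_⟩
  intro P hP
  by_contra hPb
  apply hP
  obtain ⟨x, y, hxy, rfl, hx⟩ := φ.geom.exists_of_not_mem_bad hPb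
  refine ⟨x, y, hxy, rfl, ?_, ?_, ?_⟩
  · rw [eval_aeval_X_zero]; simpa using pow_ne_zero 2 hx
  · rw [eval_aeval_X_zero]; simpa using pow_ne_zero 3 hx
  · have h1 : MvPolynomial.eval ![x, y] (Polynomial.aeval (MvPolynomial.X 0) φ.geom.U) /
        MvPolynomial.eval ![x, y] (Polynomial.aeval (MvPolynomial.X 0) (φ.geom.h ^ 2)) =
        φ.geom.valX x := by
      rw [eval_aeval_X_zero, eval_aeval_X_zero, eval_pow]; rfl
    have h2 : MvPolynomial.eval ![x, y] (Polynomial.aeval (MvPolynomial.X 0) φ.geom.S *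
        MvPolynomial.X 1 + Polynomial.aeval (MvPolynomial.X 0) φ.geom.T) /
        MvPolynomial.eval ![x, y] (Polynomial.aeval (MvPolynomial.X 0) (φ.geom.h ^ 3)) =
        φ.geom.valY x y := by
      rw [map_add, map_mul, eval_aeval_X_zero, eval_aeval_X_zero, eval_aeval_X_zero,
        MvPolynomial.eval_X, eval_pow]; rfl
    refine ⟨by rw [h1, h2]; exact φ.geom.nonsingular_val hxy.1 hx, ?_⟩
    rw [φ.geomHom_some hxy hx]
    congr 1 <;> simp only [h1, h2]

/-- **The homomorphism is defined over `K`**: it commutes with `Γ_K` (both `P ↦ g(σP)` and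
`P ↦ σ g(P)` are homomorphisms agreeing with the equivariant formula off the finite exceptional
set). [folklore] -/
theorem geomHom_smul (σ : Field.absoluteGaloisGroup K) (P : W₁.geomPoints) :
    φ.geomHom (σ • P) = σ • φ.geomHom P := by
  let g₁ : W₁.geomPoints →+ W₂.geomPoints :=
    φ.geomHom.comp (DistribSMul.toAddMonoidHom W₁.geomPoints σ)
  let g₂ : W₁.geomPoints →+ W₂.geomPoints :=
    (DistribSMul.toAddMonoidHom W₂.geomPoints σ).comp φ.geomHom
  have : g₁ = g₂ := by
    refine Literature.NumberTheory.EllipticCurves.AddMonoidHom.eq_of_eqOn_compl_finite (G := W₁.geomPoints)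
      (S := (φ.geom.bad : Set W₁.geomPoints)) φ.geom.finite_bad fun Q hQ => ?_
    show φ.geomHom (σ • Q) = σ • φ.geomHom Q
    rw [φ.geomHom_apply_of_not_mem hQ,
      φ.geomHom_apply_of_not_mem (fun h => hQ ((φ.smul_mem_bad_iff σ Q).mp h))]
    exact φ.geomFun_smul σ Q
  exact congrArg (fun g : W₁.geomPoints →+ W₂.geomPoints => g P) this

/-! #### The isogeny -/

/-- The kernel of the homomorphism is finite (it is algebraic: the tree's
`IsAlgebraicOn.finite_ker`; the kernel lies in the exceptional set). [folklore] -/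
theorem finite_ker_geomHom : (φ.geomHom.ker : Set W₁.geomPoints).Finite :=
  φ.isAlgebraicOn_geomHom.finite_ker

/-- **The isogeny attached to an isogeny formula** (Silverman, *AEC*, Thm. III.4.8: the rational
map `(x, y) ↦ (U(x)/h(x)², (S(x) y + T(x))/h(x)³)`, `O ↦ O`, is a homomorphism `E₁ → E₂`; it is
defined over `K` and has finite kernel). On `K̄`-points off the finite set `{O} ∪ {h(x) = 0}` it is
given by the formula (`toIsogeny_some`). [cite: SilvermanAEC2009, Thm. III.4.8 (PDF pp. 70–71)] -/
def toIsogeny : Isogeny W₁ W₂ where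
  toAddMonoidHom := φ.geomHom
  isAlgebraic := φ.isAlgebraicOn_geomHom
  equivariant := φ.geomHom_smul
  finite_ker := φ.finite_ker_geomHom

/-- **`W₁` and `W₂` are isogenous over `K`** as soon as an isogeny formula `W₁ → W₂` exists.
[cite: SilvermanAEC2009, Thm. III.4.8 (PDF pp. 70–71)] -/
theorem isIsogenous_of_isogenyFormula (ψ : IsogenyFormula W₁ W₂) : IsIsogenous W₁ W₂ :=
  ⟨ψ.toIsogeny⟩

/-- The isogeny on a geometric point `(x, y)` with `h(x) ≠ 0` is `(U(x)/h(x)², (S(x)y + T(x))/h(x)³)`.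
[folklore] -/
theorem toIsogeny_some {x y : AlgebraicClosure K}
    (hxy : (W₁.baseChange (AlgebraicClosure K)).toAffine.Nonsingular x y)
    (hx : φ.geom.h.eval x ≠ 0) :
    φ.toIsogeny (WeierstrassCurve.Affine.Point.some _ _ hxy) =
      WeierstrassCurve.Affine.Point.some _ _ (φ.geom.nonsingular_val hxy.1 hx) :=
  φ.geomHom_some hxy hx

end Geom

end IsogenyFormula

end WeierstrassCurve
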